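import Literature.Geometry.Lorentzian.KlainermanSzeftel2021.Dag
import Literature.Geometry.Lorentzian.KlainermanSzeftel2021.IterationAbsorption

/-!
# Klainerman–Szeftel §9.4.8 "End of the proof of the Main PT-Theorem": the iteration (Steps 1–2), the interpolation Lemma 9.4.22 (Step 3) and the top-order closure (Step 4), as real arithmetic over `Ch9Iteration`

CITATION HEADER (lean-in-tree rule 2026-08-18).  Source: S. Klainerman, J. Szeftel, *Kerr stability for small angular
momentum*, arXiv:2104.11857 (v1, 2021; TeX source `Main-Kerr-arxiv.tex`, lines quoted as `l.N`) = bib key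
`KlainermanSzeftel2021`; journal record Pure Appl. Math. Q. **19** (2023) no. 3, 791–1678 = `KlainermanSzeftel2023`
(refereed; not separately read — acquisition acq-07685 of the audit cell; the cell's CONCORDANCE.md records the
§9.4 numbering drift).  The manuscript is UNDER ADJUDICATION by the audit cell: nothing in it is cited here as a fact;
every display of [KS] enters as a HYPOTHESIS of a kernel-checked implication.

WHAT IS REPRODUCED, and in what sense.  The node "KS9.4.10 ⇐ 9.4.13 + 9.4.21 + 9.4.22" of the cell's DAG
(`Dag.lean`, shape `Ch9Iteration.Thm9410_of_children`) — the half page of bookkeeping KS §9.4.8, l.24606–24747, by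
which Theorem 9.4.10 (Main PT-Theorem, l.24053–24064: `𝔖_k + ℜ_k ≲ ε₀` for `k ≤ k_large + 7`) follows from its
children — PROVED as real arithmetic over the carrier record `Ch9Iteration` (KS Def. 9.4.9 / (9.4.26)–(9.4.34)),
with every constant and every smallness condition explicit:
* B1–B3 (Steps 1–2, l.24610–24631): Lemma 9.4.13 and Corollary 9.4.21 give the iteration assumption (9.4.33) at
  every level `k_small − 1 ≤ J ≤ k_large + 7` with the explicit constants `Ch9Iteration.iterConst n`
  (`iterKS_base`, `iterKS_succ`, `iterKS_all`), PROVIDED Cor 9.4.21 holds with one constant uniformly in the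
  constant of the iteration assumption it is fed (`∀ Cᵢ ≥ 0, Cor9421 C₂₁ Cᵢ`);
* B4 (Step 3, Lemma 9.4.22, l.24634–24700): the interpolation inequality with KS's explicit exponents
  `θ_k = (k_large+7−k)/(k_large+7−(k_small−1))` (`thetaKS`) and constant `K^{N²}` DERIVED from its only analytic
  input, the one-step inequality `L_*(p)² ≤ K L_*(p−1) L_*(p+1)` (l.24655–24662, kept as the LEAF)
  (`lemma9422_of_logConvex`, via the folklore Part A: discrete maximum principle, discrete convexity ⇒ two-point
  interpolation, zero propagation);
* B5 (Step 4, l.24702–24747): the top-order closure `ℜ_{k_large+7} + 𝔖*_{k_large+7} ≤ C_X ε₀` and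
  `ℜ_{k_large+7} + 𝔖_{k_large+7} ≤ C ε₀` (`top_Xbound`, `top_closure`) under the SINGLE smallness condition
  `C₂₁ · r₀^{−δ_B} · C₅ ≤ 1/2` ("taking r₀ large enough", l.24732);
* B6: the assembled `Ch9Iteration.thm9410_explicit : … → Thm9410 (finalConst …)` and `thm9410_of_logConvex`.
* B6′: the sharpened `thm9410_of_interpAtTop` — Lemma 9.4.22 enters at the single level `k = k_large + 6` (the other
  levels follow from `L_*` non-decreasing in `k`, `L_le_top`), constant `finalConstTop`;
* B7: the variant `thm9410_of_additiveInterp` from the ADDITIVE (Ehrling-type) interpolation leaf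
  `∀ η > 0, L_*(p) ≤ η L_*(p+1) + C(η) L_*(p−1)` in place of the multiplicative Lemma 9.4.22 — the bookkeeping half
  of the repair of the Lemma 9.4.22 proof gap suggested in the cell's GAPS.md E17b (`addInterp_all`,
  `top_Xbound_additive`, constants `addConst`, `addCX`, `addFinalConst`; `η` is chosen, not assumed).

KERNEL REMARKS recorded in the docstrings (divergence notes for the cell, not claims about [KS]'s mathematics):
(i) the bootstrap assumption BA-PT (9.4.32) (`Ch9Iteration.BAch9`) is not used by this bookkeeping — its role in
print at this node is a-priori finiteness (here: the `ℝ`-typing) and error control inside the leaves; (ii) KS's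
"then ε₀ small enough to absorb the last term" (l.24732) is not needed: the sublinear term is absorbed by Young's
inequality for every `ε₀ ≥ 0` (`IterationClosure.absorb_sublinear`); (iii) the uniformity of Cor 9.4.21's constant
in the iteration constant and (iv) `θ_{k_large+6} > 0` are genuinely used; (v) two un-numbered displays,
`L_*(k_small−1) ≲ ε₀` (l.24704–24707) and `L_*(k_large+7) ≲ ℜ_{k_large+7} + 𝔖*_{k_large+7}` with an `r₀`-independent
constant (l.24719–24735), are inputs of Step 4 that the DAG does not carve as nodes.

RELATION TO EXISTING TREE MATERIAL.  Consumes `Dag.lean` (`Ch9Iteration`, `kSmall` and the node shapes `Lemma9413`,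
`IterKS`, `Cor9421`, `Lemma9422`, `Thm9410`, name-stable) and `IterationAbsorption.lean` (`young_geom`); sits beside
`IterationStep.lean` (the same iteration step run on GKS (13.6.8) instead of KS Cor 9.4.21).  No relation to
`StabilityCauchy.lean` / `Stability.lean` / `Kerr*.lean` / the Hintz claim file.  Nothing here is
Final-State-Conjecture progress: value = kernel-checked bookkeeping edges of a typed skeleton with the smallness
conditions explicit, per the audit cell's contract (cell LEMMAS.md §4 rows "KS9.4.10 ⇐ 9.4.13 + 9.4.21 + 9.4.22" and
"KS9.4.22 interpolation lemma from log-convexity").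

Proofs: elementary real analysis, 0 sorry, axioms ⊆ {propext, Classical.choice, Quot.sound}.  Part A is folklore
(tagged so per declaration); Part B carries `[cite: KlainermanSzeftel2021, …, TeX l.N]` tags naming the display each
hypothesis/conclusion shape transcribes.
-/

noncomputable section

namespace Literature.Geometry.Lorentzian.KlainermanSzeftel2021

namespace IterationClosure

/-! ## A. Generic real lemmas: discrete maximum principle, discrete convexity ⇒ two-point interpolation,
log-convexity ⇒ multiplicative interpolation, absorption of a sublinear term. [folklore] -/

/-- Discrete maximum principle: a midpoint-convex finite sequence with non-positive endpoints is non-positive.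
[folklore] -/
theorem maxPrinciple (e : ℕ → ℝ) :
    ∀ d m : ℕ, e m ≤ 0 → e (m + d) ≤ 0 →
      (∀ p, m < p → p < m + d → 2 * e p ≤ e (p - 1) + e (p + 1)) →
      ∀ k, m ≤ k → k ≤ m + d → e k ≤ 0 := by
  intro d
  induction d with
  | zero =>
    intro m hm _ _ k hk1 hk2
    have hk : k = m := by omega
    subst hk
    exact hm
  | succ d ih =>
    intro m hm hn hconv k hk1 hk2
    by_cases hk : k = m
    · subst hk; exact hm
    by_cases h1 : e (m + 1) ≤ 0
    · have hn' : e (m + 1 + d) ≤ 0 := by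
        have h' : m + 1 + d = m + (d + 1) := by omega
        rw [h']; exact hn
      have hconv' : ∀ p, m + 1 < p → p < m + 1 + d → 2 * e p ≤ e (p - 1) + e (p + 1) :=
        fun p hp1 hp2 => hconv p (by omega) (by omega)
      exact ih (m + 1) h1 hn' hconv' k (by omega) (by omega)
    · exfalso
      push Not at h1
      have key : ∀ j, m + 1 + j ≤ m + (d + 1) →
          e (m + 1) ≤ e (m + 1 + j) ∧ e (m + 1) - e m ≤ e (m + 1 + j) - e (m + j) := by
        intro j
        induction j with
        | zero => intro _; simp
        | succ j ihj =>
          intro hj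
          obtain ⟨ha, hb⟩ := ihj (by omega)
          have hc := hconv (m + 1 + j) (by omega) (by omega)
          have e1 : m + 1 + j - 1 = m + j := by omega
          have e2 : m + 1 + j + 1 = m + 1 + (j + 1) := by omega
          have e3 : m + (j + 1) = m + 1 + j := by omega
          rw [e1, e2] at hc
          refine ⟨by linarith, ?_⟩
          rw [e3]; linarith
      have hfin := (key d (by omega)).1
      have e4 : m + 1 + d = m + (d + 1) := by omega
      rw [e4] at hfin
      linarith

/-- Discrete convexity ⇒ two-point interpolation: if `2 c_p ≤ c_{p-1} + c_{p+1}` for `m < p < m+d`, then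
`d · c_k ≤ (m+d-k) · c_m + (k-m) · c_{m+d}` for `m ≤ k ≤ m+d`. [folklore] -/
theorem convex_interp (c : ℕ → ℝ) (m d : ℕ)
    (hconv : ∀ p, m < p → p < m + d → 2 * c p ≤ c (p - 1) + c (p + 1)) :
    ∀ k, m ≤ k → k ≤ m + d →
      (d : ℝ) * c k ≤ (((m + d : ℕ) : ℝ) - k) * c m + ((k : ℝ) - m) * c (m + d) := by
  intro k hk1 hk2
  set e : ℕ → ℝ := fun q => (d : ℝ) * c q - (((m + d : ℕ) : ℝ) - q) * c m - ((q : ℝ) - m) * c (m + d)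
    with he
  have hm : e m ≤ 0 := by simp only [he]; push_cast; nlinarith
  have hn : e (m + d) ≤ 0 := by simp only [he]; push_cast; nlinarith
  have hconv' : ∀ p, m < p → p < m + d → 2 * e p ≤ e (p - 1) + e (p + 1) := by
    intro p hp1 hp2
    obtain ⟨q, rfl⟩ : ∃ q, p = q + 1 := ⟨p - 1, by omega⟩
    have hq : q + 1 - 1 = q := by omega
    have hc := hconv (q + 1) hp1 hp2
    rw [hq] at hc ⊢
    have hiden : 2 * e (q + 1) - (e q + e (q + 1 + 1))
        = (d : ℝ) * (2 * c (q + 1) - (c q + c (q + 1 + 1))) := by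
      simp only [he]; push_cast; ring
    have hd : (0 : ℝ) ≤ d := Nat.cast_nonneg d
    nlinarith
  have := maxPrinciple e d m hm hn hconv' k hk1 hk2
  simp only [he] at this
  linarith

/-- Log-convexity ⇒ multiplicative interpolation, positive case: if `a_p² ≤ K a_{p-1} a_{p+1}` for
`m < p < m+d` (`d ≥ 1`, `K > 0`, all `a_k > 0`), then for `m ≤ k ≤ m+d`
`a_k ≤ K^{(m+d-k)(k-m)/2} · a_m^{(m+d-k)/d} · a_{m+d}^{(k-m)/d}`. [folklore] -/
theorem logConvex_interp_pos (a : ℕ → ℝ) (K : ℝ) (m d : ℕ) (hK : 0 < K) (hd : 0 < d)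
    (hpos : ∀ k, m ≤ k → k ≤ m + d → 0 < a k)
    (hlc : ∀ p, m < p → p < m + d → a p ^ 2 ≤ K * (a (p - 1) * a (p + 1))) :
    ∀ k, m ≤ k → k ≤ m + d →
      a k ≤ K ^ (((((m + d : ℕ) : ℝ) - k) * ((k : ℝ) - m)) / 2)
        * a m ^ ((((m + d : ℕ) : ℝ) - k) / d) * a (m + d) ^ (((k : ℝ) - m) / d) := by
  intro k hk1 hk2
  set c : ℕ → ℝ := fun q => Real.log (a q) + Real.log K / 2 * (q : ℝ) ^ 2 with hc
  have hconv : ∀ p, m < p → p < m + d → 2 * c p ≤ c (p - 1) + c (p + 1) := by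
    intro p hp1 hp2
    obtain ⟨q, rfl⟩ : ∃ q, p = q + 1 := ⟨p - 1, by omega⟩
    have hq : q + 1 - 1 = q := by omega
    rw [hq]
    have h0 := hlc (q + 1) hp1 hp2
    rw [hq] at h0
    have ha := hpos (q + 1) (by omega) (by omega)
    have hb := hpos q (by omega) (by omega)
    have hc' := hpos (q + 1 + 1) (by omega) (by omega)
    have hlog : 2 * Real.log (a (q + 1)) ≤ Real.log K + Real.log (a q) + Real.log (a (q + 1 + 1)) := by
      have h1 : Real.log (a (q + 1) ^ 2) ≤ Real.log (K * (a q * a (q + 1 + 1))) :=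
        Real.log_le_log (by positivity) h0
      rw [Real.log_pow, Real.log_mul hK.ne' (by positivity), Real.log_mul hb.ne' hc'.ne'] at h1
      push_cast at h1
      linarith
    simp only [hc]
    push_cast
    nlinarith
  have hint := convex_interp c m d hconv k hk1 hk2
  simp only [hc] at hint
  have hdpos : (0 : ℝ) < d := by exact_mod_cast hd
  have hdR : (d : ℝ) ≠ 0 := hdpos.ne'
  -- the quadratic correction terms collapse: (n-k) m² + (k-m) n² - d k² = d (n-k)(k-m)
  have hiden : Real.log K / 2 * (((((m + d : ℕ) : ℝ) - k) * (m : ℝ) ^ 2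
      + ((k : ℝ) - m) * (((m + d : ℕ) : ℝ)) ^ 2) - (d : ℝ) * (k : ℝ) ^ 2)
      = Real.log K / 2 * ((d : ℝ) * ((((m + d : ℕ) : ℝ) - k) * ((k : ℝ) - m))) := by
    push_cast; ring
  have hmain' : (d : ℝ) * Real.log (a k) ≤ (((m + d : ℕ) : ℝ) - k) * Real.log (a m)
      + ((k : ℝ) - m) * Real.log (a (m + d))
      + (d : ℝ) * (Real.log K / 2 * ((((m + d : ℕ) : ℝ) - k) * ((k : ℝ) - m))) := by
    nlinarith [hint, hiden]
  have key : Real.log (a k) ≤ ((((m + d : ℕ) : ℝ) - k) * Real.log (a m)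
      + ((k : ℝ) - m) * Real.log (a (m + d))
      + (d : ℝ) * (Real.log K / 2 * ((((m + d : ℕ) : ℝ) - k) * ((k : ℝ) - m)))) / d := by
    rw [le_div_iff₀ hdpos]; linarith
  rw [add_div, add_div, mul_div_cancel_left₀ _ hdR] at key
  have ham := hpos m le_rfl (by omega)
  have han := hpos (m + d) (by omega) le_rfl
  have hak := hpos k hk1 hk2
  rw [← Real.log_le_log_iff hak (by positivity)]
  rw [Real.log_mul (by positivity) (by positivity), Real.log_mul (by positivity) (by positivity),
    Real.log_rpow hK, Real.log_rpow ham, Real.log_rpow han]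
  have e1 : (((m + d : ℕ) : ℝ) - k) / d * Real.log (a m) = (((m + d : ℕ) : ℝ) - k) * Real.log (a m) / d := by
    ring
  have e2 : ((k : ℝ) - m) / d * Real.log (a (m + d)) = ((k : ℝ) - m) * Real.log (a (m + d)) / d := by
    ring
  rw [e1, e2]
  linarith

/-- Zero propagation under `a_p² ≤ K a_{p-1} a_{p+1}`: one interior zero forces all interior terms to vanish. [folklore] -/
theorem logConvex_zero_propagation (a : ℕ → ℝ) (K : ℝ) (m d : ℕ)
    (hlc : ∀ p, m < p → p < m + d → a p ^ 2 ≤ K * (a (p - 1) * a (p + 1)))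
    (q : ℕ) (hq1 : m < q) (hq2 : q < m + d) (hq : a q = 0) :
    ∀ p, m < p → p < m + d → a p = 0 := by
  have down : ∀ j, m < q - j → a (q - j) = 0 := by
    intro j
    induction j with
    | zero => intro _; simpa using hq
    | succ j ih =>
      intro hj
      have hprev := ih (by omega)
      have h := hlc (q - (j + 1)) hj (by omega)
      have e1 : q - (j + 1) + 1 = q - j := by omega
      rw [e1, hprev, mul_zero, mul_zero] at h
      exact pow_eq_zero_iff (n := 2) (by norm_num) |>.mp (le_antisymm h (sq_nonneg _))
  have up : ∀ j, q + j < m + d → a (q + j) = 0 := by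
    intro j
    induction j with
    | zero => intro _; simpa using hq
    | succ j ih =>
      intro hj
      have hprev := ih (by omega)
      have h := hlc (q + (j + 1)) (by omega) hj
      have e1 : q + (j + 1) - 1 = q + j := by omega
      rw [e1, hprev, zero_mul, mul_zero] at h
      exact pow_eq_zero_iff (n := 2) (by norm_num) |>.mp (le_antisymm h (sq_nonneg _))
  intro p hp1 hp2
  rcases Nat.lt_or_ge q p with h | h
  · have := up (p - q) (by omega)
    have e : q + (p - q) = p := by omega
    rwa [e] at this
  · have := down (q - p) (by omega)
    have e : q - (q - p) = p := by omega
    rwa [e] at this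

/-- Log-convexity ⇒ multiplicative interpolation, non-negative case (`K > 0`, `d ≥ 1`):
`a_k ≤ K^{(m+d-k)(k-m)/2} · a_m^{(m+d-k)/d} · a_{m+d}^{(k-m)/d}` for `m ≤ k ≤ m+d`. [folklore] -/
theorem logConvex_interp (a : ℕ → ℝ) (K : ℝ) (m d : ℕ) (hK : 0 < K) (hd : 0 < d)
    (hnn : ∀ k, m ≤ k → k ≤ m + d → 0 ≤ a k)
    (hlc : ∀ p, m < p → p < m + d → a p ^ 2 ≤ K * (a (p - 1) * a (p + 1))) :
    ∀ k, m ≤ k → k ≤ m + d →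
      a k ≤ K ^ (((((m + d : ℕ) : ℝ) - k) * ((k : ℝ) - m)) / 2)
        * a m ^ ((((m + d : ℕ) : ℝ) - k) / d) * a (m + d) ^ (((k : ℝ) - m) / d) := by
  intro k hk1 hk2
  have hdR : (d : ℝ) ≠ 0 := by exact_mod_cast hd.ne'
  -- endpoints are unconditional
  have hend_m : a m ≤ K ^ (((((m + d : ℕ) : ℝ) - m) * ((m : ℝ) - m)) / 2)
        * a m ^ ((((m + d : ℕ) : ℝ) - m) / d) * a (m + d) ^ (((m : ℝ) - m) / d) := by
    have e1 : ((((m + d : ℕ) : ℝ) - m) * ((m : ℝ) - m)) / 2 = 0 := by ring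
    have e2 : ((((m + d : ℕ) : ℝ) - m) / d) = 1 := by push_cast; field_simp; ring
    have e3 : (((m : ℝ) - m) / d) = 0 := by ring
    rw [e1, e2, e3, Real.rpow_zero, Real.rpow_one, Real.rpow_zero]; simp
  have hend_n : a (m + d) ≤ K ^ (((((m + d : ℕ) : ℝ) - ((m + d : ℕ) : ℝ)) * ((((m + d : ℕ)) : ℝ) - m)) / 2)
        * a m ^ ((((m + d : ℕ) : ℝ) - ((m + d : ℕ) : ℝ)) / d) * a (m + d) ^ (((((m + d : ℕ)) : ℝ) - m) / d) := by
    have e1 : (((((m + d : ℕ) : ℝ) - ((m + d : ℕ) : ℝ)) * ((((m + d : ℕ)) : ℝ) - m)) / 2) = 0 := by ring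
    have e2 : ((((m + d : ℕ) : ℝ) - ((m + d : ℕ) : ℝ)) / d) = 0 := by ring
    have e3 : (((((m + d : ℕ)) : ℝ) - m) / d) = 1 := by push_cast; field_simp; ring
    rw [e1, e2, e3, Real.rpow_zero, Real.rpow_one, Real.rpow_zero]; simp
  by_cases hkm : k = m
  · subst hkm; exact hend_m
  by_cases hkn : k = m + d
  · subst hkn; exact_mod_cast hend_n
  -- k is interior
  have hki1 : m < k := by omega
  have hki2 : k < m + d := by omega
  by_cases hz : ∃ q, m < q ∧ q < m + d ∧ a q = 0
  · obtain ⟨q, hq1, hq2, hq⟩ := hz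
    have hk0 := logConvex_zero_propagation a K m d hlc q hq1 hq2 hq k hki1 hki2
    rw [hk0]
    have h1 := hnn m le_rfl (by omega)
    have h2 := hnn (m + d) (by omega) le_rfl
    positivity
  · push Not at hz
    -- all interior terms positive, hence (d ≥ 2 here) the endpoints too
    have hint_pos : ∀ p, m < p → p < m + d → 0 < a p := fun p hp1 hp2 =>
      lt_of_le_of_ne (hnn p hp1.le hp2.le) (fun h => hz p hp1 hp2 h.symm)
    have hpos : ∀ p, m ≤ p → p ≤ m + d → 0 < a p := by
      intro p hp1 hp2
      rcases Nat.lt_or_ge m p with h1 | h1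
      · rcases Nat.lt_or_ge p (m + d) with h2 | h2
        · exact hint_pos p h1 h2
        · -- p = m + d: use the interior point m + d - 1
          have hp : p = m + d := le_antisymm hp2 h2
          have hq := hint_pos (m + d - 1) (by omega) (by omega)
          have h := hlc (m + d - 1) (by omega) (by omega)
          have e1 : m + d - 1 + 1 = m + d := by omega
          rw [e1] at h
          have hprev := hnn (m + d - 1 - 1) (by omega) (by omega)
          have hlast := hnn (m + d) (by omega) le_rfl
          rw [hp]
          rcases lt_or_eq_of_le hlast with h3 | h3
          · exact h3
          · exfalso; rw [← h3, mul_zero, mul_zero] at h; nlinarith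
      · -- p = m: use the interior point m + 1
        have hp : p = m := le_antisymm h1 hp1
        have hq := hint_pos (m + 1) (by omega) (by omega)
        have h := hlc (m + 1) (by omega) (by omega)
        have e1 : m + 1 - 1 = m := by omega
        rw [e1] at h
        have hnext := hnn (m + 1 + 1) (by omega) (by omega)
        have hfirst := hnn m le_rfl (by omega)
        rw [hp]
        rcases lt_or_eq_of_le hfirst with h3 | h3
        · exact h3
        · exfalso; rw [← h3, zero_mul, mul_zero] at h; nlinarith
    exact logConvex_interp_pos a K m d hK hd hpos hlc k hk1 hk2

/-- Absorption of a sublinear term (no smallness needed): for `0 < θ < 1`, `x, e, M ≥ 0`,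
`x ≤ D e + M e^θ x^{1-θ}` implies `x ≤ 2 (D + M (2M+1)^{(1-θ)/θ}) e`. [folklore] -/
theorem absorb_sublinear {x e D M θ : ℝ} (hθ : 0 < θ) (hθ1 : θ < 1) (hx : 0 ≤ x) (he : 0 ≤ e)
    (hM : 0 ≤ M) (h : x ≤ D * e + M * (e ^ θ * x ^ (1 - θ))) :
    x ≤ 2 * (D + M * (2 * M + 1) ^ ((1 - θ) / θ)) * e := by
  set η : ℝ := (2 * M + 1) ^ ((1 - θ) / θ) with hη
  have h21 : 0 < 2 * M + 1 := by positivity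
  have hηpos : 0 < η := by positivity
  have hy := IterationAbsorption.young_geom (S := e) (Y := x) he hx hθ hθ1 hηpos
  have e3 : η ^ (-(θ / (1 - θ))) = (2 * M + 1)⁻¹ := by
    rw [hη, ← Real.rpow_mul h21.le]
    have h1θ : (1 - θ) ≠ 0 := by intro h0; linarith
    have : (1 - θ) / θ * -(θ / (1 - θ)) = -1 := by field_simp
    rw [this, Real.rpow_neg_one]
  rw [e3] at hy
  -- the x-coefficient is at most 1/2 after multiplying by M
  have hcoef : M * ((1 - θ) * ((2 * M + 1)⁻¹ * x)) ≤ x / 2 := by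
    rw [show M * ((1 - θ) * ((2 * M + 1)⁻¹ * x)) = (M * (1 - θ) / (2 * M + 1)) * x by
      field_simp]
    have : M * (1 - θ) / (2 * M + 1) ≤ 1 / 2 := by
      rw [div_le_iff₀ h21]; nlinarith
    nlinarith
  have hlin : M * (θ * (η * e)) ≤ M * η * e := by
    have : θ * (η * e) ≤ η * e := by nlinarith [mul_nonneg hηpos.le he]
    nlinarith
  have hM' : M * (e ^ θ * x ^ (1 - θ)) ≤ M * η * e + x / 2 := by
    have := mul_le_mul_of_nonneg_left hy hM
    nlinarith
  nlinarith

end IterationClosure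

/-! ## B. The §9.4.8 bookkeeping over the carrier record `Ch9Iteration` of `Dag.lean` -/

namespace Ch9Iteration

open IterationClosure

/-! ### B0. Index facts (`k_small = ⌊k_large/2⌋ + 1`, KS (3.4.6) l.6113; `k_L = k_large + 7`). -/

/-- `k_small ≥ 1`. [cite: KlainermanSzeftel2021, eq. (3.4.6), TeX l.6113] -/
theorem one_le_kS (I : Ch9Iteration) : 1 ≤ I.kS := by unfold kS kSmall; omega

/-- `k_small − 1 ≤ k_large + 6` (the Step-2 range is non-empty). [cite: KlainermanSzeftel2021, eq. (3.4.6), TeX l.6113] -/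
theorem kS_sub_one_le (I : Ch9Iteration) : I.kS - 1 ≤ I.kLarge + 6 := by unfold kS kSmall; omega

/-- `N = k_large + 7 − (k_small − 1)`: the number of iteration steps of Step 2 = the span of the interpolation
Lemma 9.4.22 (KS l.24636: the denominator of `θ_k`). [cite: KlainermanSzeftel2021, Lemma 9.4.22, TeX l.24636] -/
def span (I : Ch9Iteration) : ℕ := I.kLarge + 7 - (I.kS - 1)

/-- `N = k_large + 7 − (k_small − 1) ≥ 7`. [cite: KlainermanSzeftel2021, eq. (3.4.6), TeX l.6113] -/
theorem seven_le_span (I : Ch9Iteration) : 7 ≤ I.span := by unfold span kS kSmall; omega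

/-- `(k_small − 1) + N = k_large + 7`. [cite: KlainermanSzeftel2021, eq. (3.4.6), TeX l.6113] -/
theorem kS_sub_one_add_span (I : Ch9Iteration) : I.kS - 1 + I.span = I.kLarge + 7 := by
  unfold span kS kSmall; omega

/-- The iteration assumption (9.4.33) is monotone in its constant (given `ε₀ + L_*(J) ≥ 0`). [folklore] -/
theorem iterKS_mono (I : Ch9Iteration) {C C' : ℝ} {J : ℕ} (hCC : C ≤ C') (hpos : 0 ≤ I.ε0 + I.L J)
    (h : I.IterKS C J) : I.IterKS C' J := by
  unfold IterKS at h ⊢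
  nlinarith

/-! ### B1. Step 1 (KS l.24610–24611 with Remark 9.4.14): Lemma 9.4.13 ⇒ (9.4.33) at `J = k_small − 1`. -/

/-- Step 1 of KS §9.4.8 (l.24610–24611): `𝔖_{k_small−1} + ℜ_{k_small−1} ≤ C₁₃ ε₀` (Lemma 9.4.13 / (9.4.22)) gives
the iteration assumption (9.4.33) at `J = k_small − 1` with the same constant (using `L_* ≥ 0`, `C₁₃ ≥ 0`).
[cite: KlainermanSzeftel2021, §9.4.8 Step 1, TeX l.24610–24611] -/
theorem iterKS_base (I : Ch9Iteration) {C13 : ℝ} (h13 : I.Lemma9413 C13) (hC13 : 0 ≤ C13)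
    (hL : 0 ≤ I.L (I.kS - 1)) : I.IterKS C13 (I.kS - 1) := by
  unfold IterKS
  unfold Lemma9413 at h13
  nlinarith

/-! ### B2. Step 2, one step `J ↦ J+1` (KS l.24613–24625) with the constant explicit. -/

/-- Step 2 of KS §9.4.8, ONE STEP (l.24613–24625): Cor 9.4.21 (both parts, constant `C`, under (9.4.33) at `J`
with constant `Cᵢ`) and (9.4.33) at `J` give (9.4.33) at `J+1` with constant `C (3 + r₀^{-δ_B} + 2 r₀^{10} Cᵢ)`
("where the constant in ≲ depends on r₀", l.24622).  Uses `L_*(J) ≤ L_*(J+1)` (the norms (9.4.34) are sums over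
`≤ k` derivatives, hence non-decreasing in `k`) and `𝔖*_{J+1} ≥ 0`, `ℜ_{J+1} ≤ ℜ_{J+1} + 𝔖*_{J+1}`.
[cite: KlainermanSzeftel2021, §9.4.8 Step 2, TeX l.24613–24625] -/
theorem iterKS_succ (I : Ch9Iteration) {C Ci : ℝ} {J : ℕ}
    (hCor : I.Cor9421 C Ci) (hJ1 : I.kS - 1 ≤ J) (hJ2 : J ≤ I.kLarge + 6) (hit : I.IterKS Ci J)
    (hC : 0 ≤ C) (hCi : 0 ≤ Ci) (hr0 : 0 ≤ I.r0) (he0 : 0 ≤ I.ε0) (hLJ : 0 ≤ I.L J)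
    (hmono : I.L J ≤ I.L (J + 1)) (hSstar : 0 ≤ I.Sstar (J + 1)) :
    I.IterKS (C * (3 + I.r0 ^ (-I.δB) + 2 * I.r0 ^ (10 : ℝ) * Ci)) (J + 1) := by
  obtain ⟨h1, h2⟩ := hCor J hJ1 hJ2 hit
  unfold IterKS at hit ⊢
  have hβ : 0 ≤ I.r0 ^ (-I.δB) := Real.rpow_nonneg hr0 _
  have hρ : 0 ≤ I.r0 ^ (10 : ℝ) := Real.rpow_nonneg hr0 _
  have hLJ1 : 0 ≤ I.L (J + 1) := hLJ.trans hmono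
  have hRS : I.R J + I.S J ≤ Ci * (I.ε0 + I.L (J + 1)) := by
    have := mul_le_mul_of_nonneg_left hmono hCi
    linarith
  have hQ : I.r0 ^ (10 : ℝ) * (I.R J + I.S J) ≤ I.r0 ^ (10 : ℝ) * (Ci * (I.ε0 + I.L (J + 1))) :=
    mul_le_mul_of_nonneg_left hRS hρ
  have p1 : C * (2 * (I.r0 ^ (10 : ℝ) * (I.R J + I.S J)))
      ≤ C * (2 * (I.r0 ^ (10 : ℝ) * (Ci * (I.ε0 + I.L (J + 1))))) :=
    mul_le_mul_of_nonneg_left (by linarith) hC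
  have p2 : 0 ≤ C * I.L (J + 1) := mul_nonneg hC hLJ1
  have p3 : 0 ≤ C * ((I.r0 ^ (-I.δB) + 1) * I.ε0) := by positivity
  linarith

/-! ### B3. Step 2, all levels, with the explicit constants `iterConst`. -/

/-- The explicit constants of Step 2: `iterConst 0 = C₁₃` (Step 1) and
`iterConst (n+1) = max (iterConst n) (C₂₁ (3 + r₀^{-δ_B} + 2 r₀^{10} · iterConst n))`; the `max` makes the
sequence non-decreasing for free (harmless, (9.4.33) being monotone in its constant).  `iterConst n` is the
constant of (9.4.33) at level `J = k_small − 1 + n`. [cite: KlainermanSzeftel2021, §9.4.8 Step 2, TeX l.24613–24625] -/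
def iterConst (I : Ch9Iteration) (C13 C21 : ℝ) : ℕ → ℝ
  | 0 => C13
  | n + 1 => max (iterConst I C13 C21 n)
      (C21 * (3 + I.r0 ^ (-I.δB) + 2 * I.r0 ^ (10 : ℝ) * iterConst I C13 C21 n))

/-- `iterConst 0 = C₁₃`. [folklore] -/
@[simp] theorem iterConst_zero (I : Ch9Iteration) (C13 C21 : ℝ) : I.iterConst C13 C21 0 = C13 := rfl

/-- The recursion of `iterConst`. [folklore] -/
theorem iterConst_succ (I : Ch9Iteration) (C13 C21 : ℝ) (n : ℕ) :
    I.iterConst C13 C21 (n + 1) = max (I.iterConst C13 C21 n)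
      (C21 * (3 + I.r0 ^ (-I.δB) + 2 * I.r0 ^ (10 : ℝ) * I.iterConst C13 C21 n)) := rfl

/-- `iterConst` is non-decreasing (one step). [folklore] -/
theorem iterConst_le_succ (I : Ch9Iteration) (C13 C21 : ℝ) (n : ℕ) :
    I.iterConst C13 C21 n ≤ I.iterConst C13 C21 (n + 1) := by
  rw [iterConst_succ]; exact le_max_left _ _

/-- `iterConst` is non-decreasing. [folklore] -/
theorem iterConst_monotone (I : Ch9Iteration) (C13 C21 : ℝ) : Monotone (I.iterConst C13 C21) :=
  monotone_nat_of_le_succ (I.iterConst_le_succ C13 C21)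

/-- `iterConst n ≥ 0` when `C₁₃ ≥ 0`. [folklore] -/
theorem iterConst_nonneg (I : Ch9Iteration) {C13 : ℝ} (C21 : ℝ) (hC13 : 0 ≤ C13) (n : ℕ) :
    0 ≤ I.iterConst C13 C21 n :=
  hC13.trans (by simpa using I.iterConst_monotone C13 C21 (Nat.zero_le n))

/-- Step 2 of KS §9.4.8, ALL LEVELS (l.24613–24631): if Cor 9.4.21 holds with ONE constant `C₂₁` uniformly in the
constant of the iteration assumption it is fed (this uniformity is what "the constant in ≲ is independent of r₀"
at l.24555/24717 requires of the printed text, since the iteration constants grow with `r₀`), then (9.4.33) holds at every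
level `k_small − 1 + n ≤ k_large + 7` with the explicit constant `iterConst n`.  Inputs besides the two leaves:
`L_* ≥ 0` and non-decreasing in `k` on the range, `𝔖* ≥ 0`, `r₀ ≥ 0`, `ε₀ ≥ 0`, `C₁₃ ≥ 0`, `C₂₁ ≥ 0`.
[cite: KlainermanSzeftel2021, §9.4.8 Steps 1–2, TeX l.24610–24631] -/
theorem iterKS_all (I : Ch9Iteration) {C13 C21 : ℝ}
    (h13 : I.Lemma9413 C13) (hCor : ∀ Ci : ℝ, 0 ≤ Ci → I.Cor9421 C21 Ci)
    (hC13 : 0 ≤ C13) (hC21 : 0 ≤ C21) (hr0 : 0 ≤ I.r0) (he0 : 0 ≤ I.ε0)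
    (hL : ∀ k, I.kS - 1 ≤ k → k ≤ I.kLarge + 7 → 0 ≤ I.L k)
    (hLmono : ∀ k, I.kS - 1 ≤ k → k ≤ I.kLarge + 6 → I.L k ≤ I.L (k + 1))
    (hSstar : ∀ k, I.kS ≤ k → k ≤ I.kLarge + 7 → 0 ≤ I.Sstar k) :
    ∀ n, I.kS - 1 + n ≤ I.kLarge + 7 → I.IterKS (I.iterConst C13 C21 n) (I.kS - 1 + n) := by
  intro n
  induction n with
  | zero =>
    intro _
    simpa using I.iterKS_base h13 hC13 (hL _ le_rfl (by have := I.kS_sub_one_le; omega))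
  | succ n ih =>
    intro hn
    have hkS := I.one_le_kS
    have hprev := ih (by omega)
    have hcn : 0 ≤ I.iterConst C13 C21 n := I.iterConst_nonneg C21 hC13 n
    have hstep := I.iterKS_succ (hCor _ hcn) (J := I.kS - 1 + n) (by omega) (by omega) hprev hC21 hcn hr0
      he0 (hL _ (by omega) (by omega)) (hLmono _ (by omega) (by omega)) (hSstar _ (by omega) (by omega))
    have e : I.kS - 1 + (n + 1) = I.kS - 1 + n + 1 := by omega
    rw [e, iterConst_succ]
    refine I.iterKS_mono (le_max_right _ _) ?_ hstep
    have := hL (I.kS - 1 + n + 1) (by omega) (by omega)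
    linarith

/-- Step 2 at an arbitrary level `k_small − 1 ≤ J ≤ k_large + 7`, constant `iterConst (J − (k_small − 1))`,
weakened to the top constant `iterConst N` by monotonicity. [cite: KlainermanSzeftel2021, §9.4.8 Step 2, TeX l.24613–24631] -/
theorem iterKS_of_le (I : Ch9Iteration) {C13 C21 : ℝ}
    (h13 : I.Lemma9413 C13) (hCor : ∀ Ci : ℝ, 0 ≤ Ci → I.Cor9421 C21 Ci)
    (hC13 : 0 ≤ C13) (hC21 : 0 ≤ C21) (hr0 : 0 ≤ I.r0) (he0 : 0 ≤ I.ε0)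
    (hL : ∀ k, I.kS - 1 ≤ k → k ≤ I.kLarge + 7 → 0 ≤ I.L k)
    (hLmono : ∀ k, I.kS - 1 ≤ k → k ≤ I.kLarge + 6 → I.L k ≤ I.L (k + 1))
    (hSstar : ∀ k, I.kS ≤ k → k ≤ I.kLarge + 7 → 0 ≤ I.Sstar k)
    {J : ℕ} (hJ1 : I.kS - 1 ≤ J) (hJ2 : J ≤ I.kLarge + 7) :
    I.IterKS (I.iterConst C13 C21 I.span) J := by
  have hspan := I.kS_sub_one_add_span
  have h := I.iterKS_all h13 hCor hC13 hC21 hr0 he0 hL hLmono hSstar (J - (I.kS - 1)) (by omega)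
  have e : I.kS - 1 + (J - (I.kS - 1)) = J := by omega
  rw [e] at h
  refine I.iterKS_mono (I.iterConst_monotone C13 C21 (by omega)) ?_ h
  have := hL J hJ1 hJ2
  linarith


/-! ### B4. Step 3: Lemma 9.4.22 (interpolation for `L_*`) from the one-step log-convexity leaf. -/

/-- KS's exponent `θ_k = (k_large + 7 − k)/(k_large + 7 − (k_small − 1))` of Lemma 9.4.22 (l.24636–24638),
as demanded by the cell's referee (#5: the abstract `θ` of `Ch9Iteration.Lemma9422` must be instantiated). [cite: KlainermanSzeftel2021, Lemma 9.4.22, TeX l.24636–24638] -/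
def thetaKS (I : Ch9Iteration) (k : ℕ) : ℝ := (((I.kLarge + 7 : ℕ) : ℝ) - k) / (I.span : ℝ)

/-- `N` as a real number: `N = (k_large + 7) − (k_small − 1)`. [folklore] -/
theorem span_cast (I : Ch9Iteration) : (I.span : ℝ) = ((I.kLarge + 7 : ℕ) : ℝ) - ((I.kS - 1 : ℕ) : ℝ) := by
  have h := congrArg (Nat.cast (R := ℝ)) I.kS_sub_one_add_span
  push_cast at h ⊢
  linarith

/-- `N > 0` in `ℝ`. [folklore] -/
theorem span_pos (I : Ch9Iteration) : (0 : ℝ) < I.span := by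
  have := I.seven_le_span
  exact_mod_cast (show 0 < I.span by omega)

/-- `θ_k ≥ 0` for `k ≤ k_large + 7`. [cite: KlainermanSzeftel2021, Lemma 9.4.22, TeX l.24636–24638] -/
theorem thetaKS_nonneg (I : Ch9Iteration) {k : ℕ} (hk : k ≤ I.kLarge + 7) : 0 ≤ I.thetaKS k := by
  unfold thetaKS
  apply div_nonneg _ I.span_pos.le
  have : (k : ℝ) ≤ ((I.kLarge + 7 : ℕ) : ℝ) := by exact_mod_cast hk
  linarith

/-- `θ_k ≤ 1` for `k ≥ k_small − 1`. [cite: KlainermanSzeftel2021, Lemma 9.4.22, TeX l.24636–24638] -/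
theorem thetaKS_le_one (I : Ch9Iteration) {k : ℕ} (hk : I.kS - 1 ≤ k) : I.thetaKS k ≤ 1 := by
  unfold thetaKS
  rw [div_le_one I.span_pos, I.span_cast]
  have : ((I.kS - 1 : ℕ) : ℝ) ≤ (k : ℝ) := by exact_mod_cast hk
  linarith

/-- `θ_{k_large+6} = 1/N`. [cite: KlainermanSzeftel2021, §9.4.8 Step 4, TeX l.24702–24704] -/
theorem thetaKS_top_sub_one (I : Ch9Iteration) : I.thetaKS (I.kLarge + 6) = 1 / (I.span : ℝ) := by
  unfold thetaKS
  congr 1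
  push_cast
  ring

/-- `θ_{k_large+6} > 0`. [cite: KlainermanSzeftel2021, §9.4.8 Step 4, TeX l.24702–24704] -/
theorem thetaKS_top_sub_one_pos (I : Ch9Iteration) : 0 < I.thetaKS (I.kLarge + 6) := by
  rw [I.thetaKS_top_sub_one]; exact div_pos one_pos I.span_pos

/-- `θ_{k_large+6} < 1`. [cite: KlainermanSzeftel2021, §9.4.8 Step 4, TeX l.24702–24704] -/
theorem thetaKS_top_sub_one_lt_one (I : Ch9Iteration) : I.thetaKS (I.kLarge + 6) < 1 := by
  rw [I.thetaKS_top_sub_one, div_lt_one I.span_pos]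
  have := I.seven_le_span
  exact_mod_cast (show 1 < I.span by omega)

/-- KS Lemma 9.4.22 (l.24634–24639) DERIVED from its only analytic input, the one-step inequality
`L_*(p)² ≤ K · L_*(p−1) · L_*(p+1)` for `k_small − 1 < p < k_large + 7` ("we may integrate by parts once, which
yields …", l.24655–24662 — the LEAF; the cell's GAPS.md E17b records that the printed integration by parts omits
boundary-sphere terms): for `K ≥ 1` and `L_* ≥ 0` on the range, `Ch9Iteration.Lemma9422` holds with KS's explicit
exponents `θ_k` (`thetaKS`) and the explicit constant `K^{N²}`, `N = k_large + 7 − (k_small − 1)` (sharp form: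
`K^{(k_large+7−k)(k−k_small+1)/2}`, `IterationClosure.logConvex_interp`).  KS proves the lemma by an induction on
`p` (l.24641–24700); here it is discrete convexity of `log L_*(k) + (log K/2) k²` and a discrete maximum principle.
[cite: KlainermanSzeftel2021, Lemma 9.4.22 and its proof, TeX l.24634–24700] -/
theorem lemma9422_of_logConvex (I : Ch9Iteration) {K : ℝ} (hK : 1 ≤ K)
    (hL : ∀ k, I.kS - 1 ≤ k → k ≤ I.kLarge + 7 → 0 ≤ I.L k)
    (hlc : ∀ p, I.kS - 1 < p → p < I.kLarge + 7 → I.L p ^ 2 ≤ K * (I.L (p - 1) * I.L (p + 1))) :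
    I.Lemma9422 (K ^ (I.span * I.span)) I.thetaKS := by
  intro k hk1 hk2
  have hspan := I.kS_sub_one_add_span
  have hspos : 0 < I.span := by have := I.seven_le_span; omega
  refine ⟨I.thetaKS_nonneg hk2, I.thetaKS_le_one hk1, ?_⟩
  have hmain := logConvex_interp I.L K (I.kS - 1) I.span (by linarith) hspos
    (fun j h1 h2 => hL j h1 (by omega)) (fun p h1 h2 => hlc p h1 (by omega)) k hk1 (by omega)
  rw [hspan] at hmain
  -- identify the exponents
  have hsR := I.span_cast
  have hsne : (I.span : ℝ) ≠ 0 := I.span_pos.ne'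
  have eA : ((((I.kLarge + 7 : ℕ) : ℝ) - k) / (I.span : ℝ)) = I.thetaKS k := rfl
  have eB : (((k : ℝ) - ((I.kS - 1 : ℕ) : ℝ)) / (I.span : ℝ)) = 1 - I.thetaKS k := by
    unfold thetaKS
    field_simp
    linarith
  rw [eA, eB] at hmain
  -- bound the constant: (k_large+7-k)(k-(k_small-1))/2 ≤ N²
  have hA0 : 0 ≤ ((I.kLarge + 7 : ℕ) : ℝ) - k := by
    have : (k : ℝ) ≤ ((I.kLarge + 7 : ℕ) : ℝ) := by exact_mod_cast hk2
    linarith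
  have hB0 : 0 ≤ (k : ℝ) - ((I.kS - 1 : ℕ) : ℝ) := by
    have : ((I.kS - 1 : ℕ) : ℝ) ≤ (k : ℝ) := by exact_mod_cast hk1
    linarith
  have hA1 : ((I.kLarge + 7 : ℕ) : ℝ) - k ≤ I.span := by rw [hsR]; linarith
  have hB1 : (k : ℝ) - ((I.kS - 1 : ℕ) : ℝ) ≤ I.span := by rw [hsR]; linarith
  have hexp : (((I.kLarge + 7 : ℕ) : ℝ) - k) * ((k : ℝ) - ((I.kS - 1 : ℕ) : ℝ)) / 2
      ≤ ((I.span * I.span : ℕ) : ℝ) := by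
    rw [Nat.cast_mul]
    have hAB := mul_le_mul hA1 hB1 hB0 I.span_pos.le
    have hAB0 := mul_nonneg hA0 hB0
    linarith
  have hKpow : K ^ ((((I.kLarge + 7 : ℕ) : ℝ) - k) * ((k : ℝ) - ((I.kS - 1 : ℕ) : ℝ)) / 2)
      ≤ K ^ (I.span * I.span) := by
    rw [← Real.rpow_natCast K (I.span * I.span)]
    exact Real.rpow_le_rpow_of_exponent_le hK hexp
  have h0 := hL (I.kS - 1) le_rfl (by omega)
  have h7 := hL (I.kLarge + 7) (by omega) le_rfl
  calc I.L k ≤ K ^ ((((I.kLarge + 7 : ℕ) : ℝ) - k) * ((k : ℝ) - ((I.kS - 1 : ℕ) : ℝ)) / 2)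
        * I.L (I.kS - 1) ^ I.thetaKS k * I.L (I.kLarge + 7) ^ (1 - I.thetaKS k) := hmain
    _ ≤ K ^ (I.span * I.span) * I.L (I.kS - 1) ^ I.thetaKS k * I.L (I.kLarge + 7) ^ (1 - I.thetaKS k) := by
        have h0' : 0 ≤ I.L (I.kS - 1) ^ I.thetaKS k := Real.rpow_nonneg h0 _
        have h7' : 0 ≤ I.L (I.kLarge + 7) ^ (1 - I.thetaKS k) := Real.rpow_nonneg h7 _
        exact mul_le_mul_of_nonneg_right (mul_le_mul_of_nonneg_right hKpow h0') h7'


/-! ### B5. Step 4 (KS l.24702–24747): the top-order closure, with the absorptions explicit. -/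

/-- Step-4 constant `D = 2 C₂₁ (1 + r₀^{10} C₆)` (linear part). [cite: KlainermanSzeftel2021, §9.4.8 Step 4, TeX l.24702–24741] -/
def topD (I : Ch9Iteration) (C21 C6 : ℝ) : ℝ := 2 * C21 * (1 + I.r0 ^ (10 : ℝ) * C6)

/-- Step-4 constant `M = 2 C₂₁ r₀^{10} C₆ C₂₂ C₀^θ C₅^{1−θ}` (coefficient of the sublinear term `ε₀^θ X^{1−θ}`). [cite: KlainermanSzeftel2021, §9.4.8 Step 4, TeX l.24702–24741] -/
def topM (I : Ch9Iteration) (C21 C6 C0 C5 C22 θ : ℝ) : ℝ :=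
  2 * C21 * I.r0 ^ (10 : ℝ) * C6 * C22 * (C0 ^ θ * C5 ^ (1 - θ))

/-- Step-4 constant `C_X = 2 (D + M (2M+1)^{(1−θ)/θ})`: `ℜ_{k_large+7} + 𝔖*_{k_large+7} ≤ C_X ε₀`. [cite: KlainermanSzeftel2021, §9.4.8 Step 4, TeX l.24702–24741] -/
def topCX (I : Ch9Iteration) (C21 C6 C0 C5 C22 θ : ℝ) : ℝ :=
  2 * (I.topD C21 C6 + I.topM C21 C6 C0 C5 C22 θ * (2 * I.topM C21 C6 C0 C5 C22 θ + 1) ^ ((1 - θ) / θ))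

/-- Step-4 final constant: `ℜ_{k_large+7} + 𝔖_{k_large+7} ≤ topConst · ε₀`. [cite: KlainermanSzeftel2021, §9.4.8 Step 4, TeX l.24702–24747] -/
def topConst (I : Ch9Iteration) (C21 C6 C0 C5 C22 θ : ℝ) : ℝ :=
  (1 + C21 * C5 * (1 + I.r0 ^ (10 : ℝ) * C6 * C22)) * I.topCX C21 C6 C0 C5 C22 θ
    + C21 * (1 + I.r0 ^ (10 : ℝ) * C6 * (1 + C22 * C0))

/-- `M ≥ 0`. [folklore] -/
theorem topM_nonneg (I : Ch9Iteration) {C21 C6 C0 C5 C22 θ : ℝ} (hC21 : 0 ≤ C21) (hC6 : 0 ≤ C6)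
    (hC0 : 0 ≤ C0) (hC5 : 0 ≤ C5) (hC22 : 0 ≤ C22) (hr0 : 0 ≤ I.r0) :
    0 ≤ I.topM C21 C6 C0 C5 C22 θ := by
  unfold topM
  have := Real.rpow_nonneg hr0 (10 : ℝ)
  have := Real.rpow_nonneg hC0 θ
  have := Real.rpow_nonneg hC5 (1 - θ)
  positivity

/-- Step 4 of KS §9.4.8, FIRST HALF (l.24702–24741): the bound `ℜ_{k_large+7} + 𝔖*_{k_large+7} ≤ C_X ε₀`.
Inputs, all hypotheses: Cor 9.4.21 at `J = k_large + 6` (constant `C₂₁`, "independent of r₀", l.24717) under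
(9.4.33) at `k_large + 6` with constant `C₆` (= Step 2's output, l.24627–24631); the display `L_*(k_small−1) ≲ ε₀`
(l.24704–24707, "in view of (9.4.22)"); the display `L_*(k_large+7) ≲ ℜ_{k_large+7} + 𝔖*_{k_large+7}` with an
`r₀`-independent constant (l.24719–24735, via the choice of `u_*'` (eq:choicofuprimestarbyLebesguepointarguement));
Lemma 9.4.22 at `k = k_large + 6` with any exponent `0 < θ < 1` (KS: `θ = 1/N`); signs; and the ONE smallness
condition `C₂₁ · r₀^{−δ_B} · C₅ ≤ 1/2` ("taking r₀ large enough to absorb the first term", l.24732).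
KERNEL REMARK: KS continues "and then ε₀ small enough to absorb the last term" (l.24732); no condition on `ε₀`
is used here — the sublinear term `ε₀^θ X^{1−θ}` is absorbed by Young's inequality for ANY `ε₀ ≥ 0`
(`IterationClosure.absorb_sublinear`); what is used is that `X` is a (finite) real number, which in print is the
bootstrap assumption BA-PT (9.4.32) and here is built into the `ℝ`-typing of `Ch9Iteration`.
[cite: KlainermanSzeftel2021, §9.4.8 Step 4, TeX l.24702–24741] -/
theorem top_Xbound (I : Ch9Iteration) {C21 C6 C0 C5 C22 θ : ℝ}
    (hCor : I.Cor9421 C21 C6) (hit6 : I.IterKS C6 (I.kLarge + 6))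
    (hL0 : I.L (I.kS - 1) ≤ C0 * I.ε0)
    (hL7 : I.L (I.kLarge + 7) ≤ C5 * (I.R (I.kLarge + 7) + I.Sstar (I.kLarge + 7)))
    (hL6 : I.L (I.kLarge + 6) ≤ C22 * I.L (I.kS - 1) ^ θ * I.L (I.kLarge + 7) ^ (1 - θ))
    (hθ : 0 < θ) (hθ1 : θ < 1)
    (hC21 : 0 ≤ C21) (hC6 : 0 ≤ C6) (hC0 : 0 ≤ C0) (hC5 : 0 ≤ C5) (hC22 : 0 ≤ C22)
    (hr0 : 0 < I.r0) (he0 : 0 ≤ I.ε0) (hL0nn : 0 ≤ I.L (I.kS - 1)) (hL7nn : 0 ≤ I.L (I.kLarge + 7)) (hR7 : 0 ≤ I.R (I.kLarge + 7)) (hSs7 : 0 ≤ I.Sstar (I.kLarge + 7))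
    (hsmall : C21 * I.r0 ^ (-I.δB) * C5 ≤ 1 / 2) :
    I.R (I.kLarge + 7) + I.Sstar (I.kLarge + 7) ≤ I.topCX C21 C6 C0 C5 C22 θ * I.ε0 := by
  obtain ⟨h1, _⟩ := hCor (I.kLarge + 6) I.kS_sub_one_le le_rfl hit6
  have e67 : I.kLarge + 6 + 1 = I.kLarge + 7 := rfl
  rw [e67] at h1
  unfold IterKS at hit6
  set X := I.R (I.kLarge + 7) + I.Sstar (I.kLarge + 7) with hXdef
  have hX : 0 ≤ X := add_nonneg hR7 hSs7
  have hβ : 0 ≤ I.r0 ^ (-I.δB) := Real.rpow_nonneg hr0.le _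
  have hρ : 0 ≤ I.r0 ^ (10 : ℝ) := Real.rpow_nonneg hr0.le _
  -- absorb the r₀^{-δ_B} L_*(k_large+7) term
  have hβL : C21 * (I.r0 ^ (-I.δB) * I.L (I.kLarge + 7)) ≤ X / 2 := by
    have a1 : C21 * (I.r0 ^ (-I.δB) * I.L (I.kLarge + 7)) ≤ C21 * (I.r0 ^ (-I.δB) * (C5 * X)) :=
      mul_le_mul_of_nonneg_left (mul_le_mul_of_nonneg_left hL7 hβ) hC21
    have a2 : C21 * I.r0 ^ (-I.δB) * C5 * X ≤ 1 / 2 * X := mul_le_mul_of_nonneg_right hsmall hX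
    nlinarith
  have hX1 : X ≤ 2 * C21 * I.ε0 + 2 * C21 * (I.r0 ^ (10 : ℝ) * (I.R (I.kLarge + 6) + I.S (I.kLarge + 6))) := by
    nlinarith
  -- the previous level and the interpolation
  have hY : I.R (I.kLarge + 6) + I.S (I.kLarge + 6) ≤ C6 * (I.ε0 + I.L (I.kLarge + 6)) := by linarith
  have hsplit : (C0 * I.ε0) ^ θ * (C5 * X) ^ (1 - θ) = (C0 ^ θ * C5 ^ (1 - θ)) * (I.ε0 ^ θ * X ^ (1 - θ)) := by
    rw [Real.mul_rpow hC0 he0, Real.mul_rpow hC5 hX]; ring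
  have hL6' : I.L (I.kLarge + 6) ≤ C22 * ((C0 ^ θ * C5 ^ (1 - θ)) * (I.ε0 ^ θ * X ^ (1 - θ))) := by
    rw [← hsplit]
    have b1 : I.L (I.kS - 1) ^ θ ≤ (C0 * I.ε0) ^ θ := Real.rpow_le_rpow hL0nn hL0 hθ.le
    have b2 : I.L (I.kLarge + 7) ^ (1 - θ) ≤ (C5 * X) ^ (1 - θ) :=
      Real.rpow_le_rpow hL7nn hL7 (by linarith)
    have b3 : I.L (I.kS - 1) ^ θ * I.L (I.kLarge + 7) ^ (1 - θ) ≤ (C0 * I.ε0) ^ θ * (C5 * X) ^ (1 - θ) :=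
      mul_le_mul b1 b2 (Real.rpow_nonneg hL7nn _) (Real.rpow_nonneg (mul_nonneg hC0 he0) _)
    calc I.L (I.kLarge + 6) ≤ C22 * I.L (I.kS - 1) ^ θ * I.L (I.kLarge + 7) ^ (1 - θ) := hL6
      _ = C22 * (I.L (I.kS - 1) ^ θ * I.L (I.kLarge + 7) ^ (1 - θ)) := by ring
      _ ≤ C22 * ((C0 * I.ε0) ^ θ * (C5 * X) ^ (1 - θ)) := mul_le_mul_of_nonneg_left b3 hC22
  -- the shape `X ≤ D ε₀ + M ε₀^θ X^{1-θ}`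
  have hXineq : X ≤ I.topD C21 C6 * I.ε0
      + I.topM C21 C6 C0 C5 C22 θ * (I.ε0 ^ θ * X ^ (1 - θ)) := by
    unfold topD topM
    have c1 : I.r0 ^ (10 : ℝ) * (I.R (I.kLarge + 6) + I.S (I.kLarge + 6))
        ≤ I.r0 ^ (10 : ℝ) * (C6 * (I.ε0 + I.L (I.kLarge + 6))) := mul_le_mul_of_nonneg_left hY hρ
    have c2 : I.r0 ^ (10 : ℝ) * (C6 * I.L (I.kLarge + 6))
        ≤ I.r0 ^ (10 : ℝ) * (C6 * (C22 * ((C0 ^ θ * C5 ^ (1 - θ)) * (I.ε0 ^ θ * X ^ (1 - θ))))) :=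
      mul_le_mul_of_nonneg_left (mul_le_mul_of_nonneg_left hL6' hC6) hρ
    have p1 := mul_le_mul_of_nonneg_left c1 (by positivity : (0 : ℝ) ≤ 2 * C21)
    have p2 := mul_le_mul_of_nonneg_left c2 (by positivity : (0 : ℝ) ≤ 2 * C21)
    linarith
  have hM := I.topM_nonneg (θ := θ) hC21 hC6 hC0 hC5 hC22 hr0.le
  have := absorb_sublinear hθ hθ1 hX he0 hM hXineq
  unfold topCX
  exact this

/-- Step 4 of KS §9.4.8, SECOND HALF (l.24742–24747): with the second estimate of Cor 9.4.21 at `J = k_large + 6`,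
`ℜ_{k_large+7} + 𝔖_{k_large+7} ≤ topConst · ε₀` — Theorem 9.4.10 at the top level `k = k_large + 7`, every
constant explicit; same inputs and the same single smallness condition as `top_Xbound`.
[cite: KlainermanSzeftel2021, §9.4.8 Step 4, TeX l.24702–24747] -/
theorem top_closure (I : Ch9Iteration) {C21 C6 C0 C5 C22 θ : ℝ}
    (hCor : I.Cor9421 C21 C6) (hit6 : I.IterKS C6 (I.kLarge + 6))
    (hL0 : I.L (I.kS - 1) ≤ C0 * I.ε0)
    (hL7 : I.L (I.kLarge + 7) ≤ C5 * (I.R (I.kLarge + 7) + I.Sstar (I.kLarge + 7)))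
    (hL6 : I.L (I.kLarge + 6) ≤ C22 * I.L (I.kS - 1) ^ θ * I.L (I.kLarge + 7) ^ (1 - θ))
    (hθ : 0 < θ) (hθ1 : θ < 1)
    (hC21 : 0 ≤ C21) (hC6 : 0 ≤ C6) (hC0 : 0 ≤ C0) (hC5 : 0 ≤ C5) (hC22 : 0 ≤ C22)
    (hr0 : 0 < I.r0) (he0 : 0 ≤ I.ε0) (hL0nn : 0 ≤ I.L (I.kS - 1)) (hL7nn : 0 ≤ I.L (I.kLarge + 7)) (hR7 : 0 ≤ I.R (I.kLarge + 7)) (hSs7 : 0 ≤ I.Sstar (I.kLarge + 7))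
    (hsmall : C21 * I.r0 ^ (-I.δB) * C5 ≤ 1 / 2) :
    I.R (I.kLarge + 7) + I.S (I.kLarge + 7) ≤ I.topConst C21 C6 C0 C5 C22 θ * I.ε0 := by
  have hXb := I.top_Xbound hCor hit6 hL0 hL7 hL6 hθ hθ1 hC21 hC6 hC0 hC5 hC22 hr0 he0 hL0nn hL7nn hR7
    hSs7 hsmall
  obtain ⟨_, h2⟩ := hCor (I.kLarge + 6) I.kS_sub_one_le le_rfl hit6
  have e67 : I.kLarge + 6 + 1 = I.kLarge + 7 := rfl
  rw [e67] at h2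
  unfold IterKS at hit6
  set X := I.R (I.kLarge + 7) + I.Sstar (I.kLarge + 7) with hXdef
  have hX : 0 ≤ X := add_nonneg hR7 hSs7
  have hρ : 0 ≤ I.r0 ^ (10 : ℝ) := Real.rpow_nonneg hr0.le _
  have hCX : 0 ≤ I.topCX C21 C6 C0 C5 C22 θ * I.ε0 := hX.trans hXb
  -- linear bound for L_*(k_large+6): weighted AM–GM
  have hL6lin : I.L (I.kLarge + 6) ≤ C22 * (C0 * I.ε0 + C5 * X) := by
    have hp1 : 0 ≤ C0 * I.ε0 := mul_nonneg hC0 he0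
    have hp2 : 0 ≤ C5 * X := mul_nonneg hC5 hX
    have hyg := Real.geom_mean_le_arith_mean2_weighted (w₁ := θ) (w₂ := 1 - θ) (p₁ := C0 * I.ε0)
      (p₂ := C5 * X) hθ.le (by linarith) hp1 hp2 (by ring)
    have b1 : I.L (I.kS - 1) ^ θ ≤ (C0 * I.ε0) ^ θ := Real.rpow_le_rpow hL0nn hL0 hθ.le
    have b2 : I.L (I.kLarge + 7) ^ (1 - θ) ≤ (C5 * X) ^ (1 - θ) :=
      Real.rpow_le_rpow hL7nn hL7 (by linarith)
    have b3 : I.L (I.kS - 1) ^ θ * I.L (I.kLarge + 7) ^ (1 - θ) ≤ (C0 * I.ε0) ^ θ * (C5 * X) ^ (1 - θ) :=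
      mul_le_mul b1 b2 (Real.rpow_nonneg hL7nn _) (Real.rpow_nonneg hp1 _)
    have b4 : (C0 * I.ε0) ^ θ * (C5 * X) ^ (1 - θ) ≤ C0 * I.ε0 + C5 * X := by nlinarith
    calc I.L (I.kLarge + 6) ≤ C22 * I.L (I.kS - 1) ^ θ * I.L (I.kLarge + 7) ^ (1 - θ) := hL6
      _ = C22 * (I.L (I.kS - 1) ^ θ * I.L (I.kLarge + 7) ^ (1 - θ)) := by ring
      _ ≤ C22 * (C0 * I.ε0 + C5 * X) := mul_le_mul_of_nonneg_left (b3.trans b4) hC22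
  -- 𝔖_{k_large+7} via the second estimate of Cor 9.4.21
  have hY : I.R (I.kLarge + 6) + I.S (I.kLarge + 6)
      ≤ C6 * (I.ε0 + C22 * (C0 * I.ε0 + C5 * X)) := by
    have : C6 * (I.ε0 + I.L (I.kLarge + 6)) ≤ C6 * (I.ε0 + C22 * (C0 * I.ε0 + C5 * X)) :=
      mul_le_mul_of_nonneg_left (by linarith) hC6
    linarith
  have hS7 : I.S (I.kLarge + 7)
      ≤ C21 * (I.ε0 + C5 * X + I.r0 ^ (10 : ℝ) * (C6 * (I.ε0 + C22 * (C0 * I.ε0 + C5 * X)))) := by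
    have c1 := mul_le_mul_of_nonneg_left hY hρ
    refine h2.trans (mul_le_mul_of_nonneg_left ?_ hC21)
    linarith
  -- assemble
  have hR7le : I.R (I.kLarge + 7) ≤ X := by linarith
  have hcoef : 0 ≤ 1 + C21 * C5 * (1 + I.r0 ^ (10 : ℝ) * C6 * C22) := by positivity
  have p3 := mul_le_mul_of_nonneg_left hXb hcoef
  unfold topConst
  nlinarith [p3, hS7, hR7le, mul_nonneg hC21 he0, mul_nonneg hρ hC6]


/-! ### B6. Theorem 9.4.10 at every level with an explicit constant (Steps 1–4 assembled). -/

/-- `C_X ≥ 0`. [folklore] -/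
theorem topCX_nonneg (I : Ch9Iteration) {C21 C6 C0 C5 C22 θ : ℝ} (hC21 : 0 ≤ C21) (hC6 : 0 ≤ C6)
    (hC0 : 0 ≤ C0) (hC5 : 0 ≤ C5) (hC22 : 0 ≤ C22) (hr0 : 0 ≤ I.r0) :
    0 ≤ I.topCX C21 C6 C0 C5 C22 θ := by
  have hM := I.topM_nonneg (θ := θ) hC21 hC6 hC0 hC5 hC22 hr0
  unfold topCX topD
  have := Real.rpow_nonneg hr0 (10 : ℝ)
  positivity

/-- The final constant of Theorem 9.4.10 produced by Steps 1–4: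
`iterConst N · (1 + C₂₂ (C₀ + C₅ · C_X))` with `C_X = topCX` evaluated at the level-`(k_large+6)` iteration
constant `C₆ = iterConst (N−1)` and the interpolation exponent `θ = θ_{k_large+6}`. [cite: KlainermanSzeftel2021, Theorem 9.4.10 via §9.4.8, TeX l.24606–24747] -/
def finalConst (I : Ch9Iteration) (C13 C21 C0 C5 C22 θ6 : ℝ) : ℝ :=
  I.iterConst C13 C21 I.span
    * (1 + C22 * (C0 + C5 * I.topCX C21 (I.iterConst C13 C21 (I.span - 1)) C0 C5 C22 θ6))

/-- **KS Theorem 9.4.10 from its children, kernel-checked form** (the content of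
`Ch9Iteration.Thm9410_of_children`, §9.4.8 l.24606–24747, with every constant explicit).  HYPOTHESES = the leaves
of the cell's DAG at this node, each a verbatim KS display taken as an assumption: Lemma 9.4.13 (`Lemma9413 C₁₃`);
Cor 9.4.21 with a constant `C₂₁` UNIFORM in the iteration constant it is fed (`∀ Cᵢ ≥ 0, Cor9421 C₂₁ Cᵢ` — see
`iterKS_all`); Lemma 9.4.22 (`Lemma9422 C₂₂ θ`) with `0 < θ_{k_large+6} < 1` (KS: `= 1/N`); the two un-numbered
displays `L_*(k_small−1) ≤ C₀ ε₀` (l.24704–24707) and `L_*(k_large+7) ≤ C₅ (ℜ_{k_large+7} + 𝔖*_{k_large+7})`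
(l.24733–24735); definitional sign/monotonicity facts of the norms (9.4.1)–(9.4.9), (9.4.34) (`L_* ≥ 0` and
non-decreasing in `k`, `𝔖* ≥ 0`, `ℜ_{k_large+7} ≥ 0`, `𝔖_k + ℜ_k` non-decreasing below `k_small − 1`); `r₀ > 0`,
`ε₀ ≥ 0`, constants `≥ 0`; and ONE smallness condition, `C₂₁ r₀^{−δ_B} C₅ ≤ 1/2` ("r₀ large", l.24732).
CONCLUSION: `Thm9410 (finalConst …)`, i.e. `𝔖_k + ℜ_k ≤ C ε₀` for all `k ≤ k_large + 7` with `C` an explicit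
expression in `(C₁₃, C₂₁, C₀, C₅, C₂₂, θ_{k_large+6}, r₀, δ_B, k_large)` ONLY — not in the record's norm values
(for a fixed record with `ε₀ > 0`, `∃ C, Thm9410 C` is trivially true; the content of Theorem 9.4.10 is the
universality of `C`, which the explicit constant expresses).
WHAT THE KERNEL VERSION RECORDS vis-à-vis the printed proof and `Thm9410_of_children` (cell divergence notes, not
claims about the mathematics of [KS]): (i) the bootstrap assumption BA-PT (9.4.32) (`BAch9`, the first hypothesis
of `Thm9410_of_children`) is NOT used by the bookkeeping — in print its role at this node is a-priori finiteness
(built into the `ℝ`-typing here) and the control of error terms INSIDE the leaves (Thm 9.4.15, Props 9.4.17–9.4.20);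
(ii) "then ε₀ small enough" (l.24732) is not needed (Young); (iii) Cor 9.4.21 must be uniform in the iteration
constant (one `Citer` as in `Thm9410_of_children` does not iterate); (iv) `θ_{k_large+6} > 0` is needed (an
abstract `0 ≤ θ ≤ 1` as in `Lemma9422` alone does not absorb); (v) the two displays `hL0`, `hL7` are inputs not
carved as DAG nodes.  Nothing here is Final-State-Conjecture progress.
[cite: KlainermanSzeftel2021, Theorem 9.4.10 and §9.4.8, TeX l.24053–24064 and l.24606–24747] -/
theorem thm9410_explicit (I : Ch9Iteration) {C13 C21 C0 C5 C22 : ℝ} {θ : ℕ → ℝ}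
    (h13 : I.Lemma9413 C13) (hCor : ∀ Ci : ℝ, 0 ≤ Ci → I.Cor9421 C21 Ci) (h22 : I.Lemma9422 C22 θ)
    (hθ6 : 0 < θ (I.kLarge + 6)) (hθ6' : θ (I.kLarge + 6) < 1)
    (hL0 : I.L (I.kS - 1) ≤ C0 * I.ε0)
    (hL7 : I.L (I.kLarge + 7) ≤ C5 * (I.R (I.kLarge + 7) + I.Sstar (I.kLarge + 7)))
    (hC13 : 0 ≤ C13) (hC21 : 0 ≤ C21) (hC0 : 0 ≤ C0) (hC5 : 0 ≤ C5) (hC22 : 0 ≤ C22)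
    (hr0 : 0 < I.r0) (he0 : 0 ≤ I.ε0)
    (hL : ∀ k, I.kS - 1 ≤ k → k ≤ I.kLarge + 7 → 0 ≤ I.L k)
    (hLmono : ∀ k, I.kS - 1 ≤ k → k ≤ I.kLarge + 6 → I.L k ≤ I.L (k + 1))
    (hSstar : ∀ k, I.kS ≤ k → k ≤ I.kLarge + 7 → 0 ≤ I.Sstar k)
    (hR7 : 0 ≤ I.R (I.kLarge + 7))
    (hlow : ∀ k, k < I.kS - 1 → I.S k + I.R k ≤ I.S (I.kS - 1) + I.R (I.kS - 1))
    (hsmall : C21 * I.r0 ^ (-I.δB) * C5 ≤ 1 / 2) :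
    I.Thm9410 (I.finalConst C13 C21 C0 C5 C22 (θ (I.kLarge + 6))) := by
  intro k hk
  have hspan := I.kS_sub_one_add_span
  have h7 := I.seven_le_span
  have hkS := I.one_le_kS
  -- the level-(k_large+6) iteration constant and assumption (Step 2)
  set C6 := I.iterConst C13 C21 (I.span - 1) with hC6def
  have hC6 : 0 ≤ C6 := I.iterConst_nonneg C21 hC13 _
  have hit6 : I.IterKS C6 (I.kLarge + 6) := by
    have h := I.iterKS_all h13 hCor hC13 hC21 hr0.le he0 hL hLmono hSstar (I.span - 1) (by omega)
    have e : I.kS - 1 + (I.span - 1) = I.kLarge + 6 := by omega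
    rw [e] at h
    exact h
  -- Step 4: the X-bound
  obtain ⟨hθ0, hθ1, hL6⟩ := h22 (I.kLarge + 6) (by omega) (by omega)
  have hL0nn := hL (I.kS - 1) le_rfl (by omega)
  have hL7nn := hL (I.kLarge + 7) (by omega) le_rfl
  have hSs7 := hSstar (I.kLarge + 7) (by omega) le_rfl
  have hXb := I.top_Xbound (hCor C6 hC6) hit6 hL0 hL7 hL6 hθ6 hθ6' hC21 hC6 hC0 hC5 hC22 hr0 he0 hL0nn
    hL7nn hR7 hSs7 hsmall
  set X := I.R (I.kLarge + 7) + I.Sstar (I.kLarge + 7) with hXdef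
  have hX : 0 ≤ X := add_nonneg hR7 hSs7
  have hCXnn : 0 ≤ I.topCX C21 C6 C0 C5 C22 (θ (I.kLarge + 6)) :=
    I.topCX_nonneg hC21 hC6 hC0 hC5 hC22 hr0.le
  have hTop : 0 ≤ I.iterConst C13 C21 I.span := I.iterConst_nonneg C21 hC13 _
  have hC13le : C13 ≤ I.iterConst C13 C21 I.span := by
    simpa using I.iterConst_monotone C13 C21 (Nat.zero_le I.span)
  have hbr : 0 ≤ C22 * (C0 + C5 * I.topCX C21 C6 C0 C5 C22 (θ (I.kLarge + 6))) := by positivity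
  unfold finalConst
  rcases Nat.lt_or_ge k (I.kS - 1) with hklow | hkhigh
  · -- below k_small − 1: monotonicity of the norms and Lemma 9.4.13
    have h1 := hlow k hklow
    have h2 : I.S (I.kS - 1) + I.R (I.kS - 1) ≤ C13 * I.ε0 := h13
    have h3 : C13 * I.ε0 ≤ I.iterConst C13 C21 I.span * I.ε0 := mul_le_mul_of_nonneg_right hC13le he0
    have h4 : I.iterConst C13 C21 I.span * I.ε0 ≤ I.iterConst C13 C21 I.span
        * (1 + C22 * (C0 + C5 * I.topCX C21 C6 C0 C5 C22 (θ (I.kLarge + 6)))) * I.ε0 := by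
      have : I.iterConst C13 C21 I.span ≤ I.iterConst C13 C21 I.span
          * (1 + C22 * (C0 + C5 * I.topCX C21 C6 C0 C5 C22 (θ (I.kLarge + 6)))) :=
        le_mul_of_one_le_right hTop (by linarith)
      exact mul_le_mul_of_nonneg_right this he0
    linarith
  · -- k_small − 1 ≤ k ≤ k_large + 7: Step 2 at level k, then L_*(k) ≲ ε₀ by interpolation and the X-bound
    have hit := I.iterKS_of_le h13 hCor hC13 hC21 hr0.le he0 hL hLmono hSstar hkhigh hk
    unfold IterKS at hit
    obtain ⟨hθk0, hθk1, hLk⟩ := h22 k hkhigh hk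
    have hp1 : 0 ≤ C0 * I.ε0 := mul_nonneg hC0 he0
    have hp2 : 0 ≤ C5 * X := mul_nonneg hC5 hX
    have b1 : I.L (I.kS - 1) ^ θ k ≤ (C0 * I.ε0) ^ θ k := Real.rpow_le_rpow hL0nn hL0 hθk0
    have b2 : I.L (I.kLarge + 7) ^ (1 - θ k) ≤ (C5 * X) ^ (1 - θ k) :=
      Real.rpow_le_rpow hL7nn hL7 (by linarith)
    have b3 : I.L (I.kS - 1) ^ θ k * I.L (I.kLarge + 7) ^ (1 - θ k) ≤ (C0 * I.ε0) ^ θ k * (C5 * X) ^ (1 - θ k) :=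
      mul_le_mul b1 b2 (Real.rpow_nonneg hL7nn _) (Real.rpow_nonneg hp1 _)
    have hyg := Real.geom_mean_le_arith_mean2_weighted (w₁ := θ k) (w₂ := 1 - θ k) (p₁ := C0 * I.ε0)
      (p₂ := C5 * X) hθk0 (by linarith) hp1 hp2 (by ring)
    have c1 : θ k * (C0 * I.ε0) ≤ C0 * I.ε0 := mul_le_of_le_one_left hp1 hθk1
    have c2 : (1 - θ k) * (C5 * X) ≤ C5 * X := mul_le_of_le_one_left hp2 (by linarith)
    have b4 : (C0 * I.ε0) ^ θ k * (C5 * X) ^ (1 - θ k) ≤ C0 * I.ε0 + C5 * X := by linarith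
    have hLk' : I.L k ≤ C22 * (C0 * I.ε0 + C5 * X) := by
      calc I.L k ≤ C22 * I.L (I.kS - 1) ^ θ k * I.L (I.kLarge + 7) ^ (1 - θ k) := hLk
        _ = C22 * (I.L (I.kS - 1) ^ θ k * I.L (I.kLarge + 7) ^ (1 - θ k)) := by ring
        _ ≤ C22 * (C0 * I.ε0 + C5 * X) := mul_le_mul_of_nonneg_left (b3.trans b4) hC22
    have hLk'' : I.L k ≤ C22 * (C0 + C5 * I.topCX C21 C6 C0 C5 C22 (θ (I.kLarge + 6))) * I.ε0 := by
      have d1 : C5 * X ≤ C5 * (I.topCX C21 C6 C0 C5 C22 (θ (I.kLarge + 6)) * I.ε0) :=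
        mul_le_mul_of_nonneg_left hXb hC5
      have d2 := mul_le_mul_of_nonneg_left (add_le_add_left d1 (C0 * I.ε0)) hC22
      have d3 : C22 * (C0 * I.ε0 + C5 * (I.topCX C21 C6 C0 C5 C22 (θ (I.kLarge + 6)) * I.ε0))
          = C22 * (C0 + C5 * I.topCX C21 C6 C0 C5 C22 (θ (I.kLarge + 6))) * I.ε0 := by ring
      linarith
    have hfin : I.iterConst C13 C21 I.span * (I.ε0 + I.L k) ≤ I.iterConst C13 C21 I.span
        * (1 + C22 * (C0 + C5 * I.topCX C21 C6 C0 C5 C22 (θ (I.kLarge + 6)))) * I.ε0 := by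
      have d4 := mul_le_mul_of_nonneg_left hLk'' hTop
      have d5 : I.iterConst C13 C21 I.span
          * (1 + C22 * (C0 + C5 * I.topCX C21 C6 C0 C5 C22 (θ (I.kLarge + 6)))) * I.ε0
          = I.iterConst C13 C21 I.span * I.ε0 + I.iterConst C13 C21 I.span
            * (C22 * (C0 + C5 * I.topCX C21 C6 C0 C5 C22 (θ (I.kLarge + 6))) * I.ε0) := by ring
      rw [d5, mul_add]
      linarith
    linarith

/-- The same with Lemma 9.4.22 itself derived from the log-convexity leaf (`lemma9422_of_logConvex`): KS's
`θ_{k_large+6} = 1/N ∈ (0,1)` since `N ≥ 7`.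
[cite: KlainermanSzeftel2021, Theorem 9.4.10 and §9.4.8, TeX l.24606–24747] -/
theorem thm9410_of_logConvex (I : Ch9Iteration) {C13 C21 C0 C5 K : ℝ}
    (h13 : I.Lemma9413 C13) (hCor : ∀ Ci : ℝ, 0 ≤ Ci → I.Cor9421 C21 Ci) (hK : 1 ≤ K)
    (hlc : ∀ p, I.kS - 1 < p → p < I.kLarge + 7 → I.L p ^ 2 ≤ K * (I.L (p - 1) * I.L (p + 1)))
    (hL0 : I.L (I.kS - 1) ≤ C0 * I.ε0)
    (hL7 : I.L (I.kLarge + 7) ≤ C5 * (I.R (I.kLarge + 7) + I.Sstar (I.kLarge + 7)))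
    (hC13 : 0 ≤ C13) (hC21 : 0 ≤ C21) (hC0 : 0 ≤ C0) (hC5 : 0 ≤ C5)
    (hr0 : 0 < I.r0) (he0 : 0 ≤ I.ε0)
    (hL : ∀ k, I.kS - 1 ≤ k → k ≤ I.kLarge + 7 → 0 ≤ I.L k)
    (hLmono : ∀ k, I.kS - 1 ≤ k → k ≤ I.kLarge + 6 → I.L k ≤ I.L (k + 1))
    (hSstar : ∀ k, I.kS ≤ k → k ≤ I.kLarge + 7 → 0 ≤ I.Sstar k)
    (hR7 : 0 ≤ I.R (I.kLarge + 7))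
    (hlow : ∀ k, k < I.kS - 1 → I.S k + I.R k ≤ I.S (I.kS - 1) + I.R (I.kS - 1))
    (hsmall : C21 * I.r0 ^ (-I.δB) * C5 ≤ 1 / 2) :
    I.Thm9410 (I.finalConst C13 C21 C0 C5 (K ^ (I.span * I.span)) (I.thetaKS (I.kLarge + 6))) :=
  I.thm9410_explicit h13 hCor (I.lemma9422_of_logConvex hK hL hlc) I.thetaKS_top_sub_one_pos
    I.thetaKS_top_sub_one_lt_one hL0 hL7 hC13 hC21 hC0 hC5 (by positivity) hr0 he0 hL hLmono hSstar hR7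
    hlow hsmall

/-! ### B6′. Sharpened form: Lemma 9.4.22 is needed at `k = k_large + 6` only. -/

/-- `L_*(k) ≤ L_*(k_large + 7)` for `k_small − 1 ≤ k ≤ k_large + 7`, from `L_*` non-decreasing in `k`
(the norm (9.4.34) sums over `≤ k` derivatives). [cite: KlainermanSzeftel2021, eq. (9.4.34)–(9.4.35), TeX l.24450–24460] -/
theorem L_le_top (I : Ch9Iteration) (hLmono : ∀ k, I.kS - 1 ≤ k → k ≤ I.kLarge + 6 → I.L k ≤ I.L (k + 1))
    {k : ℕ} (hk1 : I.kS - 1 ≤ k) (hk2 : k ≤ I.kLarge + 7) : I.L k ≤ I.L (I.kLarge + 7) := by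
  obtain ⟨d, hd⟩ : ∃ d, k + d = I.kLarge + 7 := ⟨I.kLarge + 7 - k, by omega⟩
  induction d generalizing k with
  | zero =>
    have : k = I.kLarge + 7 := by omega
    rw [this]
  | succ d ih =>
    exact (hLmono k hk1 (by omega)).trans (ih (by omega) (by omega) (by omega))

/-- The final constant of the sharpened form `thm9410_of_interpAtTop`: `iterConst N · (1 + C₅ · C_X)` with
`C_X = topCX` evaluated at the level-`(k_large+6)` iteration constant `C₆ = iterConst (N−1)` and the interpolation
exponent `θ` used at `k = k_large + 6` (compare `finalConst`, which carries the factor `C₂₂ (C₀ + C₅ C_X)` because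
`thm9410_explicit` interpolates at every level). [cite: KlainermanSzeftel2021, Theorem 9.4.10 via §9.4.8, TeX l.24606–24747] -/
def finalConstTop (I : Ch9Iteration) (C13 C21 C0 C5 C22 θ : ℝ) : ℝ :=
  I.iterConst C13 C21 I.span * (1 + C5 * I.topCX C21 (I.iterConst C13 C21 (I.span - 1)) C0 C5 C22 θ)

/-- **KS Theorem 9.4.10 from its children — sharpened kernel form** (same content as `thm9410_explicit`, i.e.
`Ch9Iteration.Thm9410_of_children`, §9.4.8 l.24606–24747, with every constant explicit; sharper in that Lemma 9.4.22
is assumed at the single level `k = k_large + 6`, the other levels being handled by the monotonicity of `L_*` in `k`,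
`L_le_top`).  HYPOTHESES = the leaves
of the cell's DAG at this node, each a verbatim KS display taken as an assumption: Lemma 9.4.13 (`Lemma9413 C₁₃`);
Cor 9.4.21 with a constant `C₂₁` UNIFORM in the iteration constant it is fed (`∀ Cᵢ ≥ 0, Cor9421 C₂₁ Cᵢ` — see
`iterKS_all`); Lemma 9.4.22 AT `k = k_large + 6` ONLY, with any exponent `0 < θ < 1` (KS: `θ = 1/N`; by the
monotonicity of `L_*` in `k` no other instance of the lemma is needed); the two un-numbered displays
`L_*(k_small−1) ≤ C₀ ε₀` (l.24704–24707) and `L_*(k_large+7) ≤ C₅ (ℜ_{k_large+7} + 𝔖*_{k_large+7})` (l.24733–24735);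
definitional sign/monotonicity facts of the norms (9.4.1)–(9.4.9), (9.4.34) (`L_* ≥ 0` and non-decreasing in `k`,
`𝔖* ≥ 0`, `ℜ_{k_large+7} ≥ 0`, `𝔖_k + ℜ_k ≤ 𝔖_{k_small−1} + ℜ_{k_small−1}` below `k_small − 1`); `r₀ > 0`, `ε₀ ≥ 0`,
constants `≥ 0`; and ONE smallness condition, `C₂₁ r₀^{−δ_B} C₅ ≤ 1/2` ("r₀ large", l.24732).
CONCLUSION: `Thm9410 (finalConstTop …)`, i.e. `𝔖_k + ℜ_k ≤ C ε₀` for all `k ≤ k_large + 7` with `C` an explicit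
expression in `(C₁₃, C₂₁, C₀, C₅, C₂₂, θ, r₀, δ_B, k_large)` ONLY — not in the record's norm values (for a fixed record
with `ε₀ > 0`, `∃ C, Thm9410 C` is trivially true; the content of Theorem 9.4.10 is the universality of `C`, which
the explicit constant expresses).
WHAT THE KERNEL VERSION RECORDS vis-à-vis the printed proof and `Thm9410_of_children` (cell divergence notes, not
claims about the mathematics of [KS]): (i) the bootstrap assumption BA-PT (9.4.32) (`BAch9`, the first hypothesis of
`Thm9410_of_children`) is NOT used by the bookkeeping — in print its role at this node is a-priori finiteness (built
into the `ℝ`-typing here) and the control of error terms INSIDE the leaves (Thm 9.4.15, Props 9.4.17–9.4.20);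
(ii) "then ε₀ small enough" (l.24732) is not needed (Young); (iii) Cor 9.4.21 must be uniform in the iteration
constant (one `Citer` as in `Thm9410_of_children` does not iterate); (iv) `θ > 0` at `k_large + 6` is needed (an
abstract `0 ≤ θ ≤ 1` as in `Lemma9422` alone does not absorb) — and ONLY that instance of Lemma 9.4.22 is; (v) the
two displays `hL0`, `hL7` are inputs not carved as DAG nodes.  Nothing here is Final-State-Conjecture progress.
[cite: KlainermanSzeftel2021, Theorem 9.4.10 and §9.4.8, TeX l.24053–24064 and l.24606–24747] -/
theorem thm9410_of_interpAtTop (I : Ch9Iteration) {C13 C21 C0 C5 C22 θ : ℝ}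
    (h13 : I.Lemma9413 C13) (hCor : ∀ Ci : ℝ, 0 ≤ Ci → I.Cor9421 C21 Ci)
    (hL6 : I.L (I.kLarge + 6) ≤ C22 * I.L (I.kS - 1) ^ θ * I.L (I.kLarge + 7) ^ (1 - θ))
    (hθ : 0 < θ) (hθ1 : θ < 1)
    (hL0 : I.L (I.kS - 1) ≤ C0 * I.ε0)
    (hL7 : I.L (I.kLarge + 7) ≤ C5 * (I.R (I.kLarge + 7) + I.Sstar (I.kLarge + 7)))
    (hC13 : 0 ≤ C13) (hC21 : 0 ≤ C21) (hC0 : 0 ≤ C0) (hC5 : 0 ≤ C5) (hC22 : 0 ≤ C22)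
    (hr0 : 0 < I.r0) (he0 : 0 ≤ I.ε0)
    (hL : ∀ k, I.kS - 1 ≤ k → k ≤ I.kLarge + 7 → 0 ≤ I.L k)
    (hLmono : ∀ k, I.kS - 1 ≤ k → k ≤ I.kLarge + 6 → I.L k ≤ I.L (k + 1))
    (hSstar : ∀ k, I.kS ≤ k → k ≤ I.kLarge + 7 → 0 ≤ I.Sstar k)
    (hR7 : 0 ≤ I.R (I.kLarge + 7))
    (hlow : ∀ k, k < I.kS - 1 → I.S k + I.R k ≤ I.S (I.kS - 1) + I.R (I.kS - 1))
    (hsmall : C21 * I.r0 ^ (-I.δB) * C5 ≤ 1 / 2) :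
    I.Thm9410 (I.finalConstTop C13 C21 C0 C5 C22 θ) := by
  intro k hk
  have hspan := I.kS_sub_one_add_span
  have h7 := I.seven_le_span
  have hkS := I.one_le_kS
  -- the level-(k_large+6) iteration constant and assumption (Step 2)
  set C6 := I.iterConst C13 C21 (I.span - 1) with hC6def
  have hC6 : 0 ≤ C6 := I.iterConst_nonneg C21 hC13 _
  have hit6 : I.IterKS C6 (I.kLarge + 6) := by
    have h := I.iterKS_all h13 hCor hC13 hC21 hr0.le he0 hL hLmono hSstar (I.span - 1) (by omega)
    have e : I.kS - 1 + (I.span - 1) = I.kLarge + 6 := by omega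
    rw [e] at h
    exact h
  -- Step 4: the X-bound
  have hL0nn := hL (I.kS - 1) le_rfl (by omega)
  have hL7nn := hL (I.kLarge + 7) (by omega) le_rfl
  have hSs7 := hSstar (I.kLarge + 7) (by omega) le_rfl
  have hXb := I.top_Xbound (hCor C6 hC6) hit6 hL0 hL7 hL6 hθ hθ1 hC21 hC6 hC0 hC5 hC22 hr0 he0 hL0nn
    hL7nn hR7 hSs7 hsmall
  have hX : 0 ≤ I.R (I.kLarge + 7) + I.Sstar (I.kLarge + 7) := add_nonneg hR7 hSs7
  have hCXnn : 0 ≤ I.topCX C21 C6 C0 C5 C22 θ := I.topCX_nonneg hC21 hC6 hC0 hC5 hC22 hr0.le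
  have hTop : 0 ≤ I.iterConst C13 C21 I.span := I.iterConst_nonneg C21 hC13 _
  have hC13le : C13 ≤ I.iterConst C13 C21 I.span := by
    simpa using I.iterConst_monotone C13 C21 (Nat.zero_le I.span)
  have hbr : 0 ≤ C5 * I.topCX C21 C6 C0 C5 C22 θ := by positivity
  unfold finalConstTop
  rcases Nat.lt_or_ge k (I.kS - 1) with hklow | hkhigh
  · -- below k_small − 1: monotonicity of the norms and Lemma 9.4.13
    have h1 := hlow k hklow
    have h2 : I.S (I.kS - 1) + I.R (I.kS - 1) ≤ C13 * I.ε0 := h13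
    have h3 : C13 * I.ε0 ≤ I.iterConst C13 C21 I.span * I.ε0 := mul_le_mul_of_nonneg_right hC13le he0
    have h4 : I.iterConst C13 C21 I.span * I.ε0
        ≤ I.iterConst C13 C21 I.span * (1 + C5 * I.topCX C21 C6 C0 C5 C22 θ) * I.ε0 := by
      have : I.iterConst C13 C21 I.span ≤ I.iterConst C13 C21 I.span * (1 + C5 * I.topCX C21 C6 C0 C5 C22 θ) :=
        le_mul_of_one_le_right hTop (by linarith)
      exact mul_le_mul_of_nonneg_right this he0
    linarith
  · -- k_small − 1 ≤ k ≤ k_large + 7: Step 2 at level k, then L_*(k) ≤ L_*(k_large+7) ≤ C₅ X ≤ C₅ C_X ε₀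
    have hit := I.iterKS_of_le h13 hCor hC13 hC21 hr0.le he0 hL hLmono hSstar hkhigh hk
    unfold IterKS at hit
    have hLk : I.L k ≤ C5 * I.topCX C21 C6 C0 C5 C22 θ * I.ε0 := by
      have d1 := I.L_le_top hLmono hkhigh hk
      have d2 : C5 * (I.R (I.kLarge + 7) + I.Sstar (I.kLarge + 7)) ≤ C5 * (I.topCX C21 C6 C0 C5 C22 θ * I.ε0) :=
        mul_le_mul_of_nonneg_left hXb hC5
      linarith
    have hfin : I.iterConst C13 C21 I.span * (I.ε0 + I.L k)
        ≤ I.iterConst C13 C21 I.span * (1 + C5 * I.topCX C21 C6 C0 C5 C22 θ) * I.ε0 := by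
      have d4 := mul_le_mul_of_nonneg_left hLk hTop
      have d5 : I.iterConst C13 C21 I.span * (1 + C5 * I.topCX C21 C6 C0 C5 C22 θ) * I.ε0
          = I.iterConst C13 C21 I.span * I.ε0
            + I.iterConst C13 C21 I.span * (C5 * I.topCX C21 C6 C0 C5 C22 θ * I.ε0) := by ring
      rw [d5, mul_add]
      linarith
    linarith

/-! ### B7. Variant: Theorem 9.4.10 from the ADDITIVE (Ehrling-type) interpolation leaf.

The cell's GAPS.md E17b (adv1-g2) records that the printed proof of the one-step inequality `L_*(p)² ≲ L_*(p−1) L_*(p+1)`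
omits boundary-sphere terms and suggests the repair "additive interpolation on the cone segment + absorption in the
induction".  This section certifies the BOOKKEEPING half of that suggestion: Theorem 9.4.10 follows, with explicit
constants, from the weaker additive leaf `∀ η > 0, L_*(p) ≤ η L_*(p+1) + C(η) L_*(p−1)` (any constant function
`C(η) ≥ 0`), the multiplicative Lemma 9.4.22 being bypassed.  The analytic validity of the additive leaf is NOT
addressed here. -/

/-- The explicit constants of the additive induction: `addConst C 0 η = C η` and
`addConst C (n+1) η = 2 C(η/2) · addConst C n (1/(2 C(η/2) + 1))`. [folklore] -/
def addConst (Cadd : ℝ → ℝ) : ℕ → ℝ → ℝ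
  | 0, η => Cadd η
  | n + 1, η => 2 * Cadd (η / 2) * addConst Cadd n (1 / (2 * Cadd (η / 2) + 1))

/-- `addConst ≥ 0` when `C(η) ≥ 0` for `η > 0`. [folklore] -/
theorem addConst_nonneg {Cadd : ℝ → ℝ} (hC : ∀ η, 0 < η → 0 ≤ Cadd η) :
    ∀ n η, 0 < η → 0 ≤ addConst Cadd n η := by
  intro n
  induction n with
  | zero => intro η hη; exact hC η hη
  | succ n ih =>
    intro η hη
    have h1 := hC (η / 2) (by positivity)
    have h2 := ih (1 / (2 * Cadd (η / 2) + 1)) (by positivity)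
    show 0 ≤ 2 * Cadd (η / 2) * addConst Cadd n (1 / (2 * Cadd (η / 2) + 1))
    positivity

/-- Additive interpolation down to the base level: from `L_*(p) ≤ η L_*(p+1) + C(η) L_*(p−1)` for all `η > 0` and
`k_small − 1 < p < k_large + 7`, for every `η > 0` and every level `p = k_small − 1 + (n+1) < k_large + 7`,
`L_*(p) ≤ η L_*(p+1) + addConst C n η · L_*(k_small − 1)`. [folklore] -/
theorem addInterp_all (I : Ch9Iteration) {Cadd : ℝ → ℝ} (hC : ∀ η, 0 < η → 0 ≤ Cadd η)
    (hL : ∀ k, I.kS - 1 ≤ k → k ≤ I.kLarge + 7 → 0 ≤ I.L k)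
    (hadd : ∀ η : ℝ, 0 < η → ∀ p, I.kS - 1 < p → p < I.kLarge + 7 →
      I.L p ≤ η * I.L (p + 1) + Cadd η * I.L (p - 1)) :
    ∀ n, I.kS - 1 + (n + 1) < I.kLarge + 7 → ∀ η : ℝ, 0 < η →
      I.L (I.kS - 1 + (n + 1)) ≤ η * I.L (I.kS - 1 + (n + 1) + 1) + addConst Cadd n η * I.L (I.kS - 1) := by
  intro n
  induction n with
  | zero =>
    intro hn η hη
    have h := hadd η hη (I.kS - 1 + (0 + 1)) (by omega) hn
    have e : I.kS - 1 + (0 + 1) - 1 = I.kS - 1 := by omega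
    rw [e] at h
    exact h
  | succ n ih =>
    intro hn η hη
    set q := I.kS - 1 + (n + 1) with hq
    have e1 : I.kS - 1 + (n + 1 + 1) = q + 1 := by omega
    rw [e1]
    have hCpos := hC (η / 2) (by positivity)
    set η'' : ℝ := 1 / (2 * Cadd (η / 2) + 1) with hη''
    have hη''pos : 0 < η'' := by positivity
    have h1 := hadd (η / 2) (by positivity) (q + 1) (by omega) (by omega)
    have e2 : q + 1 - 1 = q := by omega
    rw [e2] at h1
    have h2 := ih (by omega) η'' hη''pos
    have hA : 0 ≤ addConst Cadd n η'' := addConst_nonneg hC n η'' hη''pos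
    have hL0 := hL (I.kS - 1) le_rfl (by omega)
    have hLq1 := hL (q + 1) (by omega) (by omega)
    -- C(η/2) · η'' ≤ 1/2
    have hc : Cadd (η / 2) * η'' ≤ 1 / 2 := by
      rw [hη'', mul_one_div, div_le_iff₀ (by positivity)]; linarith
    have h3 : Cadd (η / 2) * I.L q
        ≤ Cadd (η / 2) * (η'' * I.L (q + 1) + addConst Cadd n η'' * I.L (I.kS - 1)) :=
      mul_le_mul_of_nonneg_left h2 hCpos
    have h4 : Cadd (η / 2) * (η'' * I.L (q + 1)) ≤ 1 / 2 * I.L (q + 1) := by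
      have := mul_le_mul_of_nonneg_right hc hLq1
      linarith [this]
    show I.L (q + 1) ≤ η * I.L (q + 1 + 1) + 2 * Cadd (η / 2) * addConst Cadd n η'' * I.L (I.kS - 1)
    nlinarith [mul_nonneg hCpos (mul_nonneg hA hL0)]

/-- Step-4 constant for the additive variant: `ℜ_{k_large+7} + 𝔖*_{k_large+7} ≤ addCX · ε₀` with
`addCX = 4 C₂₁ (1 + r₀^{10} C₆ (1 + E C₀))`. [cite: KlainermanSzeftel2021, §9.4.8 Step 4, TeX l.24702–24741] -/
def addCX (I : Ch9Iteration) (C21 C6 C0 E : ℝ) : ℝ := 4 * C21 * (1 + I.r0 ^ (10 : ℝ) * C6 * (1 + E * C0))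

/-- Step 4, first half, ADDITIVE variant: with `L_*(k_large+6) ≤ η L_*(k_large+7) + E L_*(k_small−1)` in place of
Lemma 9.4.22, under the two smallness conditions `C₂₁ r₀^{−δ_B} C₅ ≤ 1/2` (r₀ large) and
`2 C₂₁ r₀^{10} C₆ C₅ η ≤ 1/2` (η small AFTER r₀ — η is a free parameter of the additive leaf),
`ℜ_{k_large+7} + 𝔖*_{k_large+7} ≤ addCX · ε₀`. [cite: KlainermanSzeftel2021, §9.4.8 Step 4, TeX l.24702–24741] -/
theorem top_Xbound_additive (I : Ch9Iteration) {C21 C6 C0 C5 E η : ℝ}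
    (hCor : I.Cor9421 C21 C6) (hit6 : I.IterKS C6 (I.kLarge + 6))
    (hL0 : I.L (I.kS - 1) ≤ C0 * I.ε0)
    (hL7 : I.L (I.kLarge + 7) ≤ C5 * (I.R (I.kLarge + 7) + I.Sstar (I.kLarge + 7)))
    (hL6 : I.L (I.kLarge + 6) ≤ η * I.L (I.kLarge + 7) + E * I.L (I.kS - 1))
    (hC21 : 0 ≤ C21) (hC6 : 0 ≤ C6) (hE : 0 ≤ E) (hη : 0 ≤ η)
    (hr0 : 0 < I.r0) (hR7 : 0 ≤ I.R (I.kLarge + 7)) (hSs7 : 0 ≤ I.Sstar (I.kLarge + 7))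
    (hsmall : C21 * I.r0 ^ (-I.δB) * C5 ≤ 1 / 2)
    (hsmall2 : 2 * C21 * I.r0 ^ (10 : ℝ) * C6 * C5 * η ≤ 1 / 2) :
    I.R (I.kLarge + 7) + I.Sstar (I.kLarge + 7) ≤ I.addCX C21 C6 C0 E * I.ε0 := by
  obtain ⟨h1, _⟩ := hCor (I.kLarge + 6) I.kS_sub_one_le le_rfl hit6
  have e67 : I.kLarge + 6 + 1 = I.kLarge + 7 := rfl
  rw [e67] at h1
  unfold IterKS at hit6
  set X := I.R (I.kLarge + 7) + I.Sstar (I.kLarge + 7) with hXdef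
  have hX : 0 ≤ X := add_nonneg hR7 hSs7
  have hβ : 0 ≤ I.r0 ^ (-I.δB) := Real.rpow_nonneg hr0.le _
  have hρ : 0 ≤ I.r0 ^ (10 : ℝ) := Real.rpow_nonneg hr0.le _
  have hβL : C21 * (I.r0 ^ (-I.δB) * I.L (I.kLarge + 7)) ≤ X / 2 := by
    have a1 : C21 * (I.r0 ^ (-I.δB) * I.L (I.kLarge + 7)) ≤ C21 * (I.r0 ^ (-I.δB) * (C5 * X)) :=
      mul_le_mul_of_nonneg_left (mul_le_mul_of_nonneg_left hL7 hβ) hC21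
    have a2 : C21 * I.r0 ^ (-I.δB) * C5 * X ≤ 1 / 2 * X := mul_le_mul_of_nonneg_right hsmall hX
    nlinarith
  have hY : I.R (I.kLarge + 6) + I.S (I.kLarge + 6) ≤ C6 * (I.ε0 + I.L (I.kLarge + 6)) := by linarith
  have hL6' : I.L (I.kLarge + 6) ≤ η * (C5 * X) + E * (C0 * I.ε0) := by
    have := mul_le_mul_of_nonneg_left hL7 hη
    have := mul_le_mul_of_nonneg_left hL0 hE
    linarith
  have c1 : I.r0 ^ (10 : ℝ) * (I.R (I.kLarge + 6) + I.S (I.kLarge + 6))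
      ≤ I.r0 ^ (10 : ℝ) * (C6 * (I.ε0 + (η * (C5 * X) + E * (C0 * I.ε0)))) :=
    mul_le_mul_of_nonneg_left (hY.trans (mul_le_mul_of_nonneg_left (by linarith) hC6)) hρ
  have c2 := mul_le_mul_of_nonneg_left c1 (by positivity : (0 : ℝ) ≤ 2 * C21)
  have c3 : 2 * C21 * I.r0 ^ (10 : ℝ) * C6 * C5 * η * X ≤ 1 / 2 * X := mul_le_mul_of_nonneg_right hsmall2 hX
  unfold addCX
  nlinarith

/-- The final constant of the additive variant: `iterConst N · (1 + C₅ · addCX)` with `C₆ = iterConst (N−1)`,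
`E = addConst C (N−2) η` and `η = 1/(4 C₂₁ r₀^{10} C₆ C₅ + 1)`.
[cite: KlainermanSzeftel2021, Theorem 9.4.10 via §9.4.8, TeX l.24606–24747] -/
def addFinalConst (I : Ch9Iteration) (C13 C21 C0 C5 : ℝ) (Cadd : ℝ → ℝ) : ℝ :=
  I.iterConst C13 C21 I.span * (1 + C5 * I.addCX C21 (I.iterConst C13 C21 (I.span - 1)) C0
    (addConst Cadd (I.span - 2)
      (1 / (4 * C21 * I.r0 ^ (10 : ℝ) * I.iterConst C13 C21 (I.span - 1) * C5 + 1))))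

/-- **KS Theorem 9.4.10 from the ADDITIVE interpolation leaf** (variant of `thm9410_explicit`): the multiplicative
Lemma 9.4.22 is replaced by `∀ η > 0, ∀ k_small − 1 < p < k_large + 7, L_*(p) ≤ η L_*(p+1) + C(η) L_*(p−1)` with any
`C(η) ≥ 0`; everything else as in `thm9410_explicit` (one smallness condition on `r₀`; the auxiliary `η` is CHOSEN,
`η = 1/(4 C₂₁ r₀^{10} C₆ C₅ + 1)`, not assumed).  Bookkeeping half of the repair suggested in the cell's GAPS.md
E17b; the additive leaf itself is not addressed. [cite: KlainermanSzeftel2021, Theorem 9.4.10 and §9.4.8, TeX l.24606–24747] -/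
theorem thm9410_of_additiveInterp (I : Ch9Iteration) {C13 C21 C0 C5 : ℝ} {Cadd : ℝ → ℝ}
    (h13 : I.Lemma9413 C13) (hCor : ∀ Ci : ℝ, 0 ≤ Ci → I.Cor9421 C21 Ci)
    (hCadd : ∀ η, 0 < η → 0 ≤ Cadd η)
    (hadd : ∀ η : ℝ, 0 < η → ∀ p, I.kS - 1 < p → p < I.kLarge + 7 →
      I.L p ≤ η * I.L (p + 1) + Cadd η * I.L (p - 1))
    (hL0 : I.L (I.kS - 1) ≤ C0 * I.ε0)
    (hL7 : I.L (I.kLarge + 7) ≤ C5 * (I.R (I.kLarge + 7) + I.Sstar (I.kLarge + 7)))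
    (hC13 : 0 ≤ C13) (hC21 : 0 ≤ C21) (hC0 : 0 ≤ C0) (hC5 : 0 ≤ C5)
    (hr0 : 0 < I.r0) (he0 : 0 ≤ I.ε0)
    (hL : ∀ k, I.kS - 1 ≤ k → k ≤ I.kLarge + 7 → 0 ≤ I.L k)
    (hLmono : ∀ k, I.kS - 1 ≤ k → k ≤ I.kLarge + 6 → I.L k ≤ I.L (k + 1))
    (hSstar : ∀ k, I.kS ≤ k → k ≤ I.kLarge + 7 → 0 ≤ I.Sstar k)
    (hR7 : 0 ≤ I.R (I.kLarge + 7))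
    (hlow : ∀ k, k < I.kS - 1 → I.S k + I.R k ≤ I.S (I.kS - 1) + I.R (I.kS - 1)) 
    (hsmall : C21 * I.r0 ^ (-I.δB) * C5 ≤ 1 / 2) :
    I.Thm9410 (I.addFinalConst C13 C21 C0 C5 Cadd) := by
  intro k hk
  have hspan := I.kS_sub_one_add_span
  have h7 := I.seven_le_span
  have hkS := I.one_le_kS
  have hρ : 0 ≤ I.r0 ^ (10 : ℝ) := Real.rpow_nonneg hr0.le _
  set C6 := I.iterConst C13 C21 (I.span - 1) with hC6def
  have hC6 : 0 ≤ C6 := I.iterConst_nonneg C21 hC13 _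
  have hit6 : I.IterKS C6 (I.kLarge + 6) := by
    have h := I.iterKS_all h13 hCor hC13 hC21 hr0.le he0 hL hLmono hSstar (I.span - 1) (by omega)
    have e : I.kS - 1 + (I.span - 1) = I.kLarge + 6 := by omega
    rw [e] at h
    exact h
  set η : ℝ := 1 / (4 * C21 * I.r0 ^ (10 : ℝ) * C6 * C5 + 1) with hηdef
  have hden : 0 < 4 * C21 * I.r0 ^ (10 : ℝ) * C6 * C5 + 1 := by positivity
  have hηpos : 0 < η := by positivity
  have hsmall2 : 2 * C21 * I.r0 ^ (10 : ℝ) * C6 * C5 * η ≤ 1 / 2 := by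
    rw [hηdef, mul_one_div, div_le_iff₀ hden]
    nlinarith [mul_nonneg (mul_nonneg (mul_nonneg hC21 hρ) hC6) hC5]
  set E := addConst Cadd (I.span - 2) η with hEdef
  have hE : 0 ≤ E := addConst_nonneg hCadd _ η hηpos
  have hL6 : I.L (I.kLarge + 6) ≤ η * I.L (I.kLarge + 7) + E * I.L (I.kS - 1) := by
    have h := I.addInterp_all hCadd hL hadd (I.span - 2) (by omega) η hηpos
    have e1 : I.kS - 1 + (I.span - 2 + 1) = I.kLarge + 6 := by omega
    have e2 : I.kLarge + 6 + 1 = I.kLarge + 7 := rfl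
    rw [e1, e2] at h
    exact h
  have hL7nn := hL (I.kLarge + 7) (by omega) le_rfl
  have hSs7 := hSstar (I.kLarge + 7) (by omega) le_rfl
  have hXb := I.top_Xbound_additive (hCor C6 hC6) hit6 hL0 hL7 hL6 hC21 hC6 hE hηpos.le hr0 hR7 hSs7 hsmall
    hsmall2
  have hX : 0 ≤ I.R (I.kLarge + 7) + I.Sstar (I.kLarge + 7) := add_nonneg hR7 hSs7
  have hCXnn : 0 ≤ I.addCX C21 C6 C0 E := by unfold addCX; positivity
  have hTop : 0 ≤ I.iterConst C13 C21 I.span := I.iterConst_nonneg C21 hC13 _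
  have hC13le : C13 ≤ I.iterConst C13 C21 I.span := by
    simpa using I.iterConst_monotone C13 C21 (Nat.zero_le I.span)
  have hbr : 0 ≤ C5 * I.addCX C21 C6 C0 E := by positivity
  unfold addFinalConst
  rcases Nat.lt_or_ge k (I.kS - 1) with hklow | hkhigh
  · have h1 := hlow k hklow
    have h2 : I.S (I.kS - 1) + I.R (I.kS - 1) ≤ C13 * I.ε0 := h13
    have h3 : C13 * I.ε0 ≤ I.iterConst C13 C21 I.span * I.ε0 := mul_le_mul_of_nonneg_right hC13le he0
    have h4 : I.iterConst C13 C21 I.span * I.ε0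
        ≤ I.iterConst C13 C21 I.span * (1 + C5 * I.addCX C21 C6 C0 E) * I.ε0 := by
      have : I.iterConst C13 C21 I.span ≤ I.iterConst C13 C21 I.span * (1 + C5 * I.addCX C21 C6 C0 E) :=
        le_mul_of_one_le_right hTop (by linarith)
      exact mul_le_mul_of_nonneg_right this he0
    linarith
  · have hit := I.iterKS_of_le h13 hCor hC13 hC21 hr0.le he0 hL hLmono hSstar hkhigh hk
    unfold IterKS at hit
    have hLk : I.L k ≤ C5 * I.addCX C21 C6 C0 E * I.ε0 := by
      have d1 := I.L_le_top hLmono hkhigh hk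
      have d2 : C5 * (I.R (I.kLarge + 7) + I.Sstar (I.kLarge + 7)) ≤ C5 * (I.addCX C21 C6 C0 E * I.ε0) :=
        mul_le_mul_of_nonneg_left hXb hC5
      linarith
    have hfin : I.iterConst C13 C21 I.span * (I.ε0 + I.L k)
        ≤ I.iterConst C13 C21 I.span * (1 + C5 * I.addCX C21 C6 C0 E) * I.ε0 := by
      have d4 := mul_le_mul_of_nonneg_left hLk hTop
      have d5 : I.iterConst C13 C21 I.span * (1 + C5 * I.addCX C21 C6 C0 E) * I.ε0
          = I.iterConst C13 C21 I.span * I.ε0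
            + I.iterConst C13 C21 I.span * (C5 * I.addCX C21 C6 C0 E * I.ε0) := by ring
      rw [d5, mul_add]
      linarith
    linarith

end Ch9Iteration

end Literature.Geometry.Lorentzian.KlainermanSzeftel2021

end
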